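import Literature.Analysis.PDE.FrameOpCommutator
import Literature.Analysis.PDE.SlabGlobalize
import HarnessLib

/-!
# Approximate solutions of linear parabolic systems on a closed manifold, glued from flat
# approximate solutions in the charts of a patch system (topic `Analysis/PDE`)

Layer (I') of the programme to prove short-time existence for quasilinear strictly parabolic
systems on a closed manifold (hypothesis `hQL` of
`Literature.Geometry.Riemannian.ricciFlow_shortTime_existence_of_quasilinear`). Setting: a patch
system `P` on `M` with Euclidean model `E'`; a time-dependent linear operator `L s` on functions
`M → F'` which, in every chart `p` of `P`, is represented by a frame operator with coefficient
fields `S p, 𝔟 p, 𝔠 p` smooth on `[0, T] × target` (`hL`), with `S p (0, ·)` self-adjoint and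
uniformly coercive and with small temporal oscillation on `closedBall 0 (4 rₚ)`; a source `Θ`
with slab-smooth chart expressions. The **outer Neumann iteration**: localise the source with
the partition of unity (`rhoExpr`), solve approximately and with `λ`-gain bounds in each chart by
the flat approximate solution operator (`exists_flatApproxSolve`, applied to the cut-off
coefficient fields `symbC, firstC, zeroC`), glue with the cut-offs; the new source is the sum of
the globalised commutators `commOp` (first order in the flat solutions, hence `λ⁻¹`-small in the
weighted norms), plus the globalised inner residuals (arbitrarily small). Iterating `N` times and
choosing the inner tolerance last gives the main result `exists_manifoldApproxSolve`: for every
`ε > 0` a chart-slab-smooth `v` with `v(0) = 0` and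

  `∂ₜ v = L v + Θ - R` on `[0, T] × M`,  `E_k(cutExpr P p (R s)) ≤ ε` (`k + 1 ≤ K`, all `s, p`).

Everything is proved; no named fact and no `sorry` is introduced.

## References

* L. Hörmander, *The Analysis of Linear Partial Differential Operators III*, Springer 1985,
  §17.1 (parametrices by localisation and patching). [Hormander1985III]
* J. M. Lee, *Introduction to Smooth Manifolds*, 2nd ed., Springer 2013, Thm. 2.23. [Lee2013]
-/

noncomputable section

open Set Function Filter Topology Metric MeasureTheory InnerProductSpace
open scoped Manifold ContDiff Topology ENNReal RealInnerProductSpace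

namespace Literature.Analysis.PDE

open Literature.Geometry.Manifold Literature.Analysis.FunctionSpaces Literature.Analysis.FluidPDE

variable {E : Type*} [NormedAddCommGroup E] [NormedSpace ℝ E] {H : Type*} [TopologicalSpace H]
variable {I : ModelWithCorners ℝ E H} {M : Type*} [TopologicalSpace M] [ChartedSpace H M]
variable {E' : Type*} [NormedAddCommGroup E'] [InnerProductSpace ℝ E'] [FiniteDimensional ℝ E']
variable {F' : Type*} [NormedAddCommGroup F'] [InnerProductSpace ℝ F']
variable {ι : Type*} [Fintype ι] (P : PatchSystem I M E' ι) {T : ℝ}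

namespace PatchSystemLoc

/-! ### The cut-off coefficient fields of a chart -/

/-- **The cut-off symbol field of chart `p`**: `1 + cutPlus_p • (S_p - 1)` — equal to `S_p` on
`tsupport cut_p`, the identity outside `closedBall 0 (4rₚ)`. [cite: Hormander1985III, §17.1] -/
def symbC (p : ι) (S : ι → ℝ → E' → (E' →L[ℝ] E')) (s : ℝ) (y : E') : E' →L[ℝ] E' :=
  1 + P.cutPlus p y • (S p s y - 1)

/-- The cut-off first-order coefficient field of chart `p`. [cite: Hormander1985III, §17.1] -/
def firstC (p : ι) (𝔟 : ι → ℝ → E' → ((E' →L[ℝ] F') →L[ℝ] F')) (s : ℝ) (y : E') : (E' →L[ℝ] F') →L[ℝ] F' :=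
  P.cutPlus p y • 𝔟 p s y

/-- The cut-off zeroth-order coefficient field of chart `p`. [cite: Hormander1985III, §17.1] -/
def zeroC (p : ι) (𝔠 : ι → ℝ → E' → (F' →L[ℝ] F')) (s : ℝ) (y : E') : F' →L[ℝ] F' :=
  P.cutPlus p y • 𝔠 p s y

section Coeff

variable {P} {S : ι → ℝ → E' → (E' →L[ℝ] E')} {𝔟 : ι → ℝ → E' → ((E' →L[ℝ] F') →L[ℝ] F')}
  {𝔠 : ι → ℝ → E' → (F' →L[ℝ] F')}

/-- `symbC_apply`: unfolding. [folklore] -/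
theorem symbC_apply (p : ι) (s : ℝ) (y : E') : symbC P p S s y = 1 + P.cutPlus p y • (S p s y - 1) := rfl

/-- `firstC_apply`: unfolding. [folklore] -/
theorem firstC_apply (p : ι) (s : ℝ) (y : E') : firstC P p 𝔟 s y = P.cutPlus p y • 𝔟 p s y := rfl

/-- `zeroC_apply`: unfolding. [folklore] -/
theorem zeroC_apply (p : ι) (s : ℝ) (y : E') : zeroC P p 𝔠 s y = P.cutPlus p y • 𝔠 p s y := rfl

/-- Off `closedBall 0 (4rₚ)` the outer cut-off vanishes. [folklore] -/
theorem cutPlus_eq_zero_of_le (p : ι) {y : E'} (hy : 4 * P.r p ≤ ‖y‖) : P.cutPlus p y = 0 :=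
  (P.cutPlus p).zero_of_le_dist (by rwa [dist_zero_right, PatchSystem.cutPlus_rOut])

/-- On `tsupport cut_p` the cut-off coefficients are the true ones. [folklore] -/
theorem symbC_eq_of_mem (p : ι) (s : ℝ) {y : E'} (hy : y ∈ tsupport (P.cut p)) : symbC P p S s y = S p s y := by
  rw [symbC_apply, P.cutPlus_eq_one_of_mem_tsupport_cut p hy, one_smul, add_sub_cancel]

/-- `firstC_eq_of_mem`: firstC eq of mem. [folklore] -/
theorem firstC_eq_of_mem (p : ι) (s : ℝ) {y : E'} (hy : y ∈ tsupport (P.cut p)) : firstC P p 𝔟 s y = 𝔟 p s y := by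
  rw [firstC_apply, P.cutPlus_eq_one_of_mem_tsupport_cut p hy, one_smul]

/-- `zeroC_eq_of_mem`: zeroC eq of mem. [folklore] -/
theorem zeroC_eq_of_mem (p : ι) (s : ℝ) {y : E'} (hy : y ∈ tsupport (P.cut p)) : zeroC P p 𝔠 s y = 𝔠 p s y := by
  rw [zeroC_apply, P.cutPlus_eq_one_of_mem_tsupport_cut p hy, one_smul]

/-- Constancy outside the ball: `symbC = 1`. [folklore] -/
theorem symbC_eq_one (p : ι) (s : ℝ) {y : E'} (hy : 4 * P.r p ≤ ‖y‖) : symbC P p S s y = 1 := by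
  rw [symbC_apply, cutPlus_eq_zero_of_le p hy, zero_smul, add_zero]

/-- Constancy outside the ball: `firstC = 0`. [folklore] -/
theorem firstC_eq_zero (p : ι) (s : ℝ) {y : E'} (hy : 4 * P.r p ≤ ‖y‖) : firstC P p 𝔟 s y = 0 := by
  rw [firstC_apply, cutPlus_eq_zero_of_le p hy, zero_smul]

/-- Constancy outside the ball: `zeroC = 0`. [folklore] -/
theorem zeroC_eq_zero (p : ι) (s : ℝ) {y : E'} (hy : 4 * P.r p ≤ ‖y‖) : zeroC P p 𝔠 s y = 0 := by
  rw [zeroC_apply, cutPlus_eq_zero_of_le p hy, zero_smul]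

/-- `0 ≤ cutPlus ≤ 1`. [folklore] -/
theorem cutPlus_mem_Icc (p : ι) (y : E') : P.cutPlus p y ∈ Icc (0 : ℝ) 1 := ⟨(P.cutPlus p).nonneg, (P.cutPlus p).le_one⟩

section Smooth

variable [I.Boundaryless]

/-- **Slab smoothness of the cut-off symbol field.** [folklore] -/
theorem isSmoothSpaceTimeOn_symbC (p : ι) (hS : ContDiffOn ℝ ∞ (uncurry (S p)) (Icc 0 T ×ˢ (P.chart p).target)) :
    IsSmoothSpaceTimeOn (Icc 0 T) (symbC P p S) := by
  have h := contDiffOn_slab_smul_of_tsupport_subset (P.chart p).isOpen_target (P.cutPlus p).contDiff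
    (P.tsupport_cutPlus_subset p) (G := fun s y ↦ S p s y - 1) (hS.sub contDiffOn_const)
  have heq : symbC P p S = fun s y ↦ (1 : E' →L[ℝ] E') + P.cutPlus p y • (S p s y - 1) := rfl
  rw [heq]
  exact contDiffOn_const.add h

/-- **Slab smoothness of the cut-off first-order field.** [folklore] -/
theorem isSmoothSpaceTimeOn_firstC (p : ι) (h𝔟 : ContDiffOn ℝ ∞ (uncurry (𝔟 p)) (Icc 0 T ×ˢ (P.chart p).target)) :
    IsSmoothSpaceTimeOn (Icc 0 T) (firstC P p 𝔟) :=
  contDiffOn_slab_smul_of_tsupport_subset (P.chart p).isOpen_target (P.cutPlus p).contDiff (P.tsupport_cutPlus_subset p) h𝔟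

/-- **Slab smoothness of the cut-off zeroth-order field.** [folklore] -/
theorem isSmoothSpaceTimeOn_zeroC (p : ι) (h𝔠 : ContDiffOn ℝ ∞ (uncurry (𝔠 p)) (Icc 0 T ×ˢ (P.chart p).target)) :
    IsSmoothSpaceTimeOn (Icc 0 T) (zeroC P p 𝔠) :=
  contDiffOn_slab_smul_of_tsupport_subset (P.chart p).isOpen_target (P.cutPlus p).contDiff (P.tsupport_cutPlus_subset p) h𝔠

end Smooth

/-- **Self-adjointness of the cut-off symbol at time `0`** from self-adjointness of `S p 0` on
`closedBall 0 (4rₚ)`. [folklore] -/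
theorem adjoint_symbC_zero (p : ι) (hsym : ∀ y ∈ closedBall (0 : E') (4 * P.r p), ContinuousLinearMap.adjoint (S p 0 y) = S p 0 y)
    (y : E') : ContinuousLinearMap.adjoint (symbC P p S 0 y) = symbC P p S 0 y := by
  haveI : CompleteSpace E' := FiniteDimensional.complete ℝ E'
  by_cases hy : y ∈ closedBall (0 : E') (4 * P.r p)
  · have hS : ∀ x z : E', ⟪S p 0 y x, z⟫ = ⟪x, S p 0 y z⟫ := fun x z ↦ by
      rw [← ContinuousLinearMap.adjoint_inner_left, hsym y hy]
    symm
    rw [ContinuousLinearMap.eq_adjoint_iff]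
    intro x z
    have happ : ∀ w : E', symbC P p S 0 y w = w + P.cutPlus p y • (S p 0 y w - w) := fun w ↦ by
      simp [symbC_apply]
    rw [happ, happ, inner_add_left, inner_add_right, real_inner_smul_left, real_inner_smul_right, inner_sub_left,
      inner_sub_right, hS]
  · have hy' : 4 * P.r p ≤ ‖y‖ := by rw [mem_closedBall, dist_zero_right] at hy; linarith
    rw [symbC_eq_one p 0 hy', ContinuousLinearMap.one_def, ContinuousLinearMap.adjoint_id]

/-- **Coercivity of the cut-off symbol at time `0`** with constant `min 1 ν₀` (convex combination of
the identity and a `ν₀`-coercive operator). [folklore] -/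
theorem coercive_symbC_zero (p : ι) {ν₀ : ℝ} (hcoer : ∀ y ∈ closedBall (0 : E') (4 * P.r p), ∀ ξ : E', ν₀ * ‖ξ‖ ^ 2 ≤ ⟪S p 0 y ξ, ξ⟫)
    (y ξ : E') : min 1 ν₀ * ‖ξ‖ ^ 2 ≤ ⟪symbC P p S 0 y ξ, ξ⟫ := by
  obtain ⟨hc0, hc1⟩ := cutPlus_mem_Icc (P := P) p y
  have hmin1 : min 1 ν₀ ≤ 1 := min_le_left _ _
  have hmin2 : min 1 ν₀ ≤ ν₀ := min_le_right _ _
  have happ : symbC P p S 0 y ξ = ξ + P.cutPlus p y • (S p 0 y ξ - ξ) := by simp [symbC_apply]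
  have hexp : ⟪symbC P p S 0 y ξ, ξ⟫ = (1 - P.cutPlus p y) * ‖ξ‖ ^ 2 + P.cutPlus p y * ⟪S p 0 y ξ, ξ⟫ := by
    rw [happ, inner_add_left, real_inner_smul_left, inner_sub_left, real_inner_self_eq_norm_sq]
    ring
  rw [hexp]
  by_cases hy : y ∈ closedBall (0 : E') (4 * P.r p)
  · have h := hcoer y hy ξ
    have h1 : (1 - P.cutPlus p y) * (min 1 ν₀ * ‖ξ‖ ^ 2) ≤ (1 - P.cutPlus p y) * ‖ξ‖ ^ 2 :=
      mul_le_mul_of_nonneg_left (by nlinarith [sq_nonneg ‖ξ‖]) (by linarith)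
    have h2 : P.cutPlus p y * (min 1 ν₀ * ‖ξ‖ ^ 2) ≤ P.cutPlus p y * ⟪S p 0 y ξ, ξ⟫ :=
      mul_le_mul_of_nonneg_left ((mul_le_mul_of_nonneg_right hmin2 (sq_nonneg _)).trans h) hc0
    calc min 1 ν₀ * ‖ξ‖ ^ 2 = (1 - P.cutPlus p y) * (min 1 ν₀ * ‖ξ‖ ^ 2) + P.cutPlus p y * (min 1 ν₀ * ‖ξ‖ ^ 2) := by ring
      _ ≤ _ := add_le_add h1 h2
  · have hy' : 4 * P.r p ≤ ‖y‖ := by rw [mem_closedBall, dist_zero_right] at hy; linarith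
    rw [cutPlus_eq_zero_of_le p hy']
    nlinarith [sq_nonneg ‖ξ‖]

/-- **Temporal oscillation of the cut-off symbol.** [folklore] -/
theorem norm_symbC_sub_le (p : ι) {εo : ℝ} (hosc : ∀ s ∈ Icc 0 T, ∀ y ∈ closedBall (0 : E') (4 * P.r p), ‖S p s y - S p 0 y‖ ≤ εo)
    (hεo0 : 0 ≤ εo) {s : ℝ} (hs : s ∈ Icc 0 T) (y : E') : ‖symbC P p S s y - symbC P p S 0 y‖ ≤ εo := by
  obtain ⟨hc0, hc1⟩ := cutPlus_mem_Icc (P := P) p y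
  have heq : symbC P p S s y - symbC P p S 0 y = P.cutPlus p y • (S p s y - S p 0 y) := by
    rw [symbC_apply, symbC_apply, add_sub_add_left_eq_sub, ← smul_sub, sub_sub_sub_cancel_right]
  rw [heq, norm_smul, Real.norm_eq_abs, abs_of_nonneg hc0]
  by_cases hy : y ∈ closedBall (0 : E') (4 * P.r p)
  · calc P.cutPlus p y * ‖S p s y - S p 0 y‖ ≤ 1 * εo := mul_le_mul hc1 (hosc s hs y hy) (norm_nonneg _) zero_le_one
      _ = εo := one_mul εo
  · have hy' : 4 * P.r p ≤ ‖y‖ := by rw [mem_closedBall, dist_zero_right] at hy; linarith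
    rw [cutPlus_eq_zero_of_le p hy', zero_mul]
    exact hεo0

end Coeff

/-! ### The operator through its chart representations -/

section Operator

variable {P} [IsManifold I ∞ M] [I.Boundaryless] [T2Space M]
  {S : ι → ℝ → E' → (E' →L[ℝ] E')} {𝔟 : ι → ℝ → E' → ((E' →L[ℝ] F') →L[ℝ] F')} {𝔠 : ι → ℝ → E' → (F' →L[ℝ] F')}
  {L : ℝ → (M → F') → M → F'}

omit [IsManifold I ∞ M] [T2Space M] in
/-- **A represented operator annihilates functions vanishing near the point.** [folklore] -/
theorem op_eq_zero_of_eventuallyEq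
    (hL : ∀ s ∈ Icc 0 T, ∀ u : M → F', (∀ q, ContDiffOn ℝ ∞ (u ∘ (P.chart q).inv) (P.chart q).target) →
      ∀ p, ∀ y ∈ (P.chart p).target, L s u ((P.chart p).inv y) = frameOp (S p s y) (𝔟 p s y) (𝔠 p s y) (u ∘ (P.chart p).inv) y)
    {s : ℝ} (hs : s ∈ Icc 0 T) {u : M → F'} (hu : ∀ q, ContDiffOn ℝ ∞ (u ∘ (P.chart q).inv) (P.chart q).target)
    {x : M} (hx : u =ᶠ[𝓝 x] fun _ ↦ 0) : L s u x = 0 := by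
  obtain ⟨p, hxs, -⟩ := P.cover x
  have hy : (P.chart p).map x ∈ (P.chart p).target := (P.chart p).map_mem_target hxs
  have h1 : L s u x = L s u ((P.chart p).inv ((P.chart p).map x)) := by rw [(P.chart p).inv_map hxs]
  rw [h1, hL s hs u hu p _ hy]
  refine frameOp_eq_zero_of_eventuallyEq_zero _ _ _ ?_
  have hcont : ContinuousAt (P.chart p).inv ((P.chart p).map x) :=
    (P.chart p).continuousOn_inv.continuousAt ((P.chart p).isOpen_target.mem_nhds hy)
  have hx' : u =ᶠ[𝓝 ((P.chart p).inv ((P.chart p).map x))] fun _ ↦ 0 := by rwa [(P.chart p).inv_map hxs]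
  exact hcont.eventually hx'

omit [IsManifold I ∞ M] [T2Space M] in
/-- **A represented operator is additive on functions with smooth chart expressions.** [folklore] -/
theorem op_sum
    (hL : ∀ s ∈ Icc 0 T, ∀ u : M → F', (∀ q, ContDiffOn ℝ ∞ (u ∘ (P.chart q).inv) (P.chart q).target) →
      ∀ p, ∀ y ∈ (P.chart p).target, L s u ((P.chart p).inv y) = frameOp (S p s y) (𝔟 p s y) (𝔠 p s y) (u ∘ (P.chart p).inv) y)
    {s : ℝ} (hs : s ∈ Icc 0 T) {ι' : Type*} [Fintype ι'] {u : ι' → M → F'}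
    (hu : ∀ i q, ContDiffOn ℝ ∞ (u i ∘ (P.chart q).inv) (P.chart q).target) (x : M) :
    L s (fun x ↦ ∑ i, u i x) x = ∑ i, L s (u i) x := by
  obtain ⟨p, hxs, -⟩ := P.cover x
  have hy : (P.chart p).map x ∈ (P.chart p).target := (P.chart p).map_mem_target hxs
  have hsum : ∀ q, ContDiffOn ℝ ∞ ((fun x ↦ ∑ i, u i x) ∘ (P.chart q).inv) (P.chart q).target := by
    intro q
    have : ((fun x ↦ ∑ i, u i x) ∘ (P.chart q).inv) = fun y ↦ ∑ i, (u i ∘ (P.chart q).inv) y := by funext y; simp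
    rw [this]
    exact ContDiffOn.sum fun i _ ↦ hu i q
  rw [← (P.chart p).inv_map hxs, hL s hs _ hsum p _ hy]
  have h2 : ((fun x ↦ ∑ i, u i x) ∘ (P.chart p).inv) = fun y ↦ ∑ i, (u i ∘ (P.chart p).inv) y := by funext y; simp
  rw [h2, frameOp_sum_of_contDiffOn _ _ _ (P.chart p).isOpen_target hy (fun i ↦ hu i p)]
  exact Finset.sum_congr rfl fun i _ ↦ (hL s hs _ (hu i) p _ hy).symm

/-- Chart expressions of the globalisation of a cut-off smooth function are smooth. [folklore] -/
theorem contDiffOn_globalize_cut_smul_comp_inv (p q : ι) {w : E' → F'} (hw : ContDiff ℝ ∞ w) :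
    ContDiffOn ℝ ∞ ((P.chart p).globalize (fun y ↦ P.cut p y • w y) ∘ (P.chart q).inv) (P.chart q).target :=
  (P.chart p).contDiffOn_globalize_comp_inv (P.chart q) (((P.cut p).contDiff.smul hw).contDiffOn)
    (isCompact_closedBall 0 (3 * P.r p)) (P.closedBall_subset_target p (by norm_num))
    ((tsupport_smul_subset_left _ _).trans (by rw [ContDiffBump.tsupport_eq, PatchSystem.cut_rOut]))

omit [IsManifold I ∞ M] [I.Boundaryless] in
/-- The globalisation of a cut-off function vanishes near every point outside the chart source.
[folklore] -/
theorem globalize_cut_smul_eventuallyEq_zero (p : ι) (w : E' → F') {x : M} (hx : x ∉ (P.chart p).source) :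
    (P.chart p).globalize (fun y ↦ P.cut p y • w y) =ᶠ[𝓝 x] fun _ ↦ 0 := by
  obtain ⟨hKc, hKs⟩ := (P.chart p).isCompact_image_inv (isCompact_closedBall (0 : E') (3 * P.r p))
    (P.closedBall_subset_target p (by norm_num))
  have hxK : x ∉ (P.chart p).inv '' closedBall (0 : E') (3 * P.r p) := fun h ↦ hx (hKs h)
  filter_upwards [hKc.isClosed.isOpen_compl.mem_nhds hxK] with x' hx'
  refine (P.chart p).globalize_eq_zero fun h ↦ hx' ?_
  rw [(P.chart p).image_inv_eq (P.closedBall_subset_target p (by norm_num))]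
  refine ⟨h.1, ?_⟩
  have h2 : (P.chart p).map x' ∈ tsupport (P.cut p) := tsupport_smul_subset_left _ _ h.2
  rwa [ContDiffBump.tsupport_eq, PatchSystem.cut_rOut] at h2

/-- **The operator on a glued piece**: for `w` smooth on the model and `s ∈ [0, T]`,
`L s (globalize_p (cut_p • w)) = globalize_p (frameOp (symbC p s) (firstC p s) (zeroC p s) (cut_p • w))`
everywhere on `M` (representation in chart `p`, locality of the frame operator, and
`cutPlus_p = 1` on `tsupport cut_p`). [cite: Hormander1985III, §17.1] -/
theorem op_globalize_cut_smul
    (hL : ∀ s ∈ Icc 0 T, ∀ u : M → F', (∀ q, ContDiffOn ℝ ∞ (u ∘ (P.chart q).inv) (P.chart q).target) →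
      ∀ p, ∀ y ∈ (P.chart p).target, L s u ((P.chart p).inv y) = frameOp (S p s y) (𝔟 p s y) (𝔠 p s y) (u ∘ (P.chart p).inv) y)
    {s : ℝ} (hs : s ∈ Icc 0 T) (p : ι) {w : E' → F'} (hw : ContDiff ℝ ∞ w) (x : M) :
    L s ((P.chart p).globalize fun y ↦ P.cut p y • w y) x =
      (P.chart p).globalize (fun y ↦ frameOp (symbC P p S s y) (firstC P p 𝔟 s y) (zeroC P p 𝔠 s y) (fun z ↦ P.cut p z • w z) y) x := by
  have hV : ∀ q, ContDiffOn ℝ ∞ ((P.chart p).globalize (fun y ↦ P.cut p y • w y) ∘ (P.chart q).inv) (P.chart q).target :=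
    fun q ↦ contDiffOn_globalize_cut_smul_comp_inv p q hw
  by_cases hxs : x ∈ (P.chart p).source
  · set y := (P.chart p).map x with hy'
    have hy : y ∈ (P.chart p).target := (P.chart p).map_mem_target hxs
    rw [(P.chart p).globalize_of_mem hxs, ← hy', ← (P.chart p).inv_map hxs, ← hy', hL s hs _ hV p y hy]
    -- the chart expression is the cut-off function near `y`
    have hev : ((P.chart p).globalize (fun y ↦ P.cut p y • w y) ∘ (P.chart p).inv) =ᶠ[𝓝 y] fun z ↦ P.cut p z • w z := by
      filter_upwards [(P.chart p).isOpen_target.mem_nhds hy] with z hz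
      exact (P.chart p).globalize_inv hz
    rw [frameOp_congr_of_eventuallyEq _ _ _ hev]
    by_cases hyc : y ∈ tsupport (P.cut p)
    · rw [symbC_eq_of_mem p s hyc, firstC_eq_of_mem p s hyc, zeroC_eq_of_mem p s hyc]
    · have hev0 : (fun z ↦ P.cut p z • w z) =ᶠ[𝓝 y] fun _ ↦ 0 := by
        filter_upwards [notMem_tsupport_iff_eventuallyEq.1 hyc] with z hz
        simp [hz]
      rw [frameOp_eq_zero_of_eventuallyEq_zero _ _ _ hev0, frameOp_eq_zero_of_eventuallyEq_zero _ _ _ hev0]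
  · rw [(P.chart p).globalize_of_notMem hxs]
    exact op_eq_zero_of_eventuallyEq hL hs hV (globalize_cut_smul_eventuallyEq_zero p w hxs)

end Operator

/-! ### Algebra of globalisations and partition expressions -/

section Algebra

variable {P}

omit [FiniteDimensional ℝ E'] [InnerProductSpace ℝ F'] [Fintype ι] in
/-- `globalize_add`: globalize add. [folklore] -/
theorem globalize_add (κ : FramedChart I M E') (f g : E' → F') (x : M) :
    κ.globalize (fun y ↦ f y + g y) x = κ.globalize f x + κ.globalize g x := by
  by_cases hx : x ∈ κ.source
  · simp [FramedChart.globalize_of_mem _ hx]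
  · simp [FramedChart.globalize_of_notMem _ hx]

omit [FiniteDimensional ℝ E'] [InnerProductSpace ℝ F'] [Fintype ι] in
/-- `globalize_sub`: globalize sub. [folklore] -/
theorem globalize_sub (κ : FramedChart I M E') (f g : E' → F') (x : M) :
    κ.globalize (fun y ↦ f y - g y) x = κ.globalize f x - κ.globalize g x := by
  by_cases hx : x ∈ κ.source
  · simp [FramedChart.globalize_of_mem _ hx]
  · simp [FramedChart.globalize_of_notMem _ hx]

omit [FiniteDimensional ℝ E'] [InnerProductSpace ℝ F'] [Fintype ι] in
/-- `globalize_zero_fun`: globalize of the zero function. [folklore] -/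
theorem globalize_zero_fun (κ : FramedChart I M E') (x : M) : κ.globalize (fun _ : E' ↦ (0 : F')) x = 0 := by
  by_cases hx : x ∈ κ.source
  · simp [FramedChart.globalize_of_mem _ hx]
  · simp [FramedChart.globalize_of_notMem _ hx]

/-- `rhoExpr_add`: the partition expression is additive in the function. [folklore] -/
theorem rhoExpr_add (q : ι) (f g : M → F') (y : E') :
    rhoExpr P q (fun x ↦ f x + g x) y = rhoExpr P q f y + rhoExpr P q g y := by
  simp [rhoExpr_apply, smul_add]

/-- `rhoExpr_sub`: rhoExpr sub. [folklore] -/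
theorem rhoExpr_sub (q : ι) (f g : M → F') (y : E') :
    rhoExpr P q (fun x ↦ f x - g x) y = rhoExpr P q f y - rhoExpr P q g y := by
  simp [rhoExpr_apply, smul_sub]

/-- `rhoExpr_sum`: rhoExpr of a finite sum. [folklore] -/
theorem rhoExpr_sum (q : ι) {ι' : Type*} (t : Finset ι') (f : ι' → M → F') (y : E') :
    rhoExpr P q (fun x ↦ ∑ i ∈ t, f i x) y = ∑ i ∈ t, rhoExpr P q (f i) y := by
  simp [rhoExpr_apply, Finset.smul_sum]

/-- `cut_p • rhoExpr p f = rhoExpr p f` (`cut_p = 1` on `closedBall 0 (2rₚ) ⊇ tsupport ρ̂_p`). [folklore] -/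
theorem cut_smul_rhoExpr (p : ι) (f : M → F') (y : E') : P.cut p y • rhoExpr P p f y = rhoExpr P p f y := by
  by_cases hy : y ∈ closedBall (0 : E') (2 * P.r p)
  · rw [(P.cut p).one_of_mem_closedBall (by rwa [PatchSystem.cut_rIn]), one_smul]
  · rw [rhoExpr_eq_zero P p f hy, smul_zero]

end Algebra

/-! ### One step of the outer iteration -/

section Step

variable {P} [IsManifold I ∞ M] [I.Boundaryless] [T2Space M] [MeasurableSpace E'] [BorelSpace E']
  {S : ι → ℝ → E' → (E' →L[ℝ] E')} {𝔟 : ι → ℝ → E' → ((E' →L[ℝ] F') →L[ℝ] F')} {𝔠 : ι → ℝ → E' → (F' →L[ℝ] F')}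
  {L : ℝ → (M → F') → M → F'}


omit [FiniteDimensional ℝ E'] [IsManifold I ∞ M] [I.Boundaryless] [T2Space M] [MeasurableSpace E'] [BorelSpace E'] in
/-- Time differentiability passes through the globalisation. [folklore] -/
theorem differentiableWithinAt_globalize (κ : FramedChart I M E') {g : ℝ → E' → F'} {S' : Set ℝ} {s : ℝ}
    (hg : ∀ y, DifferentiableWithinAt ℝ (fun s ↦ g s y) S' s) (x : M) :
    DifferentiableWithinAt ℝ (fun s ↦ κ.globalize (g s) x) S' s := by
  by_cases hx : x ∈ κ.source
  · simp only [κ.globalize_of_mem hx]; exact hg _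
  · simp only [κ.globalize_of_notMem hx]; exact differentiableWithinAt_const _

set_option maxHeartbeats 1600000 in
/-- **One step of the outer iteration.** Given approximate solution operators with `λ`-gain
bounds for the cut-off coefficient fields of every chart (`hbox`, from `exists_flatApproxSolve`),
there are finite constants `C_ir, C_D, C_Dsup` such that every source `Θ` with slab-smooth chart
expressions and every inner tolerance `ε' > 0` admit chart-slab-smooth `V, ir, D` with `V(0) = 0`
and

* `∂ₜ V = L V + Θ - ir - D` on `[0, T] × M` (glued local solutions; `D` = globalised commutators,
  `ir` = globalised inner residuals);
* `E_k(rhoExpr q (ir s)) ≤ C_ir ε'` (`k + 1 ≤ K`);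
* `Σ_q ∫₀ᵗ e^{-2λs} E_k(rhoExpr q (D s)) ≤ C_D λ⁻¹ Σ_p ∫₀ᵗ e^{-2λs} E_k(rhoExpr p (Θ s))` and
  `E_k(rhoExpr q (D s)) ≤ C_Dsup e^{2λs} Σ_p ∫₀ˢ e^{-2λσ} E_k(rhoExpr p (Θ σ))` for `λ ≥ Λ_b`, `k ≤ K`.
[cite: Hormander1985III, §17.1] -/
theorem outer_step (hT : 0 < T)
    (hS : ∀ p, ContDiffOn ℝ ∞ (uncurry (S p)) (Icc 0 T ×ˢ (P.chart p).target))
    (h𝔟 : ∀ p, ContDiffOn ℝ ∞ (uncurry (𝔟 p)) (Icc 0 T ×ˢ (P.chart p).target))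
    (h𝔠 : ∀ p, ContDiffOn ℝ ∞ (uncurry (𝔠 p)) (Icc 0 T ×ˢ (P.chart p).target))
    (hL : ∀ s ∈ Icc 0 T, ∀ u : M → F', (∀ q, ContDiffOn ℝ ∞ (u ∘ (P.chart q).inv) (P.chart q).target) →
      ∀ p, ∀ y ∈ (P.chart p).target, L s u ((P.chart p).inv y) = frameOp (S p s y) (𝔟 p s y) (𝔠 p s y) (u ∘ (P.chart p).inv) y)
    (K : ℕ) {Λb : ℝ} {Cbox Csup : ℝ≥0∞} (hCboxtop : Cbox ≠ ⊤) (hCsuptop : Csup ≠ ⊤)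
    (hbox : ∀ p, ∀ {Θf : ℝ → E' → F'}, IsSmoothSpaceTimeOn (Icc 0 T) Θf →
      (∀ s y, Θf s y ≠ 0 → y ∈ closedBall (0 : E') (2 * P.r p)) → ∀ {ε : ℝ}, 0 < ε → ∃ v r : ℝ → E' → F',
      IsSmoothSpaceTimeOn (Icc 0 T) v ∧ IsSmoothSpaceTimeOn (Icc 0 T) r ∧ (∀ y, v 0 y = 0) ∧
      (∀ s ∈ Icc 0 T, ∀ y, timeDerivWithin (Icc 0 T) v s y =
        frameOp (symbC P p S s y) (firstC P p 𝔟 s y) (zeroC P p 𝔠 s y) (v s) y + Θf s y - r s y) ∧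
      (∀ k, k + 1 ≤ K → ∀ s ∈ Icc 0 T, sobolevEnergy k (r s) ≤ ENNReal.ofReal ε) ∧
      (∀ {lam : ℝ}, Λb ≤ lam → ∀ k ≤ K, ∀ t ∈ Icc 0 T,
        ∫⁻ s in Ioo 0 t, (fun (lam s : ℝ) ↦ ENNReal.ofReal (Real.exp (-2 * lam * s))) lam s * ((∑ a, sobolevEnergy k (fun y ↦ fderiv ℝ (v s) y (stdOrthonormalBasis ℝ E' a))) +
          sobolevEnergy k (v s)) ≤ Cbox * ENNReal.ofReal lam⁻¹ * ∫⁻ s in Ioo 0 t, (fun (lam s : ℝ) ↦ ENNReal.ofReal (Real.exp (-2 * lam * s))) lam s * sobolevEnergy k (Θf s)) ∧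
      (∀ {lam : ℝ}, Λb ≤ lam → ∀ k ≤ K, ∀ s ∈ Icc 0 T,
        (∑ a, sobolevEnergy k (fun y ↦ fderiv ℝ (v s) y (stdOrthonormalBasis ℝ E' a))) + sobolevEnergy k (v s) ≤
          Csup * ENNReal.ofReal (Real.exp (2 * lam * s)) * ∫⁻ σ in Ioo 0 s, (fun (lam s : ℝ) ↦ ENNReal.ofReal (Real.exp (-2 * lam * s))) lam σ * sobolevEnergy k (Θf σ))) :
    ∃ Cir CD CDsup : ℝ≥0∞, Cir ≠ ⊤ ∧ CD ≠ ⊤ ∧ CDsup ≠ ⊤ ∧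
      ∀ {Θ : ℝ → M → F'}, (∀ q, ContDiffOn ℝ ∞ (uncurry fun s y ↦ Θ s ((P.chart q).inv y)) (Icc 0 T ×ˢ (P.chart q).target)) →
      ∀ {ε' : ℝ}, 0 < ε' → ∃ V ir D : ℝ → M → F',
        (∀ q, ContDiffOn ℝ ∞ (uncurry fun s y ↦ V s ((P.chart q).inv y)) (Icc 0 T ×ˢ (P.chart q).target)) ∧
        (∀ q, ContDiffOn ℝ ∞ (uncurry fun s y ↦ ir s ((P.chart q).inv y)) (Icc 0 T ×ˢ (P.chart q).target)) ∧
        (∀ q, ContDiffOn ℝ ∞ (uncurry fun s y ↦ D s ((P.chart q).inv y)) (Icc 0 T ×ˢ (P.chart q).target)) ∧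
        (∀ x, V 0 x = 0) ∧
        (∀ s ∈ Icc 0 T, ∀ x, derivWithin (fun s ↦ V s x) (Icc 0 T) s = L s (V s) x + Θ s x - ir s x - D s x) ∧
        (∀ k, k + 1 ≤ K → ∀ s ∈ Icc 0 T, ∀ q, sobolevEnergy k (rhoExpr P q (ir s)) ≤ Cir * ENNReal.ofReal ε') ∧
        (∀ {lam : ℝ}, Λb ≤ lam → ∀ k ≤ K, ∀ t ∈ Icc 0 T,
          ∑ q, ∫⁻ s in Ioo 0 t, (fun (lam s : ℝ) ↦ ENNReal.ofReal (Real.exp (-2 * lam * s))) lam s * sobolevEnergy k (rhoExpr P q (D s)) ≤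
            CD * ENNReal.ofReal lam⁻¹ * ∑ p, ∫⁻ s in Ioo 0 t, (fun (lam s : ℝ) ↦ ENNReal.ofReal (Real.exp (-2 * lam * s))) lam s * sobolevEnergy k (rhoExpr P p (Θ s))) ∧
        (∀ {lam : ℝ}, Λb ≤ lam → ∀ k ≤ K, ∀ s ∈ Icc 0 T, ∀ q,
          sobolevEnergy k (rhoExpr P q (D s)) ≤ CDsup * ENNReal.ofReal (Real.exp (2 * lam * s)) *
            ∑ p, ∫⁻ σ in Ioo 0 s, (fun (lam s : ℝ) ↦ ENNReal.ofReal (Real.exp (-2 * lam * s))) lam σ * sobolevEnergy k (rhoExpr P p (Θ σ))) := by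
  classical
  /- ## constants -/
  have htr := fun q p k ↦ exists_rhoExpr_globalize_le P (F := F') q p k
  choose Ctr hCtrtop hCtr using htr
  have hsymbs : ∀ p, IsSmoothSpaceTimeOn (Icc 0 T) (symbC P p S) := fun p ↦ isSmoothSpaceTimeOn_symbC p (hS p)
  have hfirsts : ∀ p, IsSmoothSpaceTimeOn (Icc 0 T) (firstC P p 𝔟) := fun p ↦ isSmoothSpaceTimeOn_firstC p (h𝔟 p)
  have hzeros : ∀ p, IsSmoothSpaceTimeOn (Icc 0 T) (zeroC P p 𝔠) := fun p ↦ isSmoothSpaceTimeOn_zeroC p (h𝔠 p)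
  have hMc := fun p ↦ exists_bound_iteratedFDeriv_of_hasCompactSupport (P.cut p).contDiff (P.cut p).hasCompactSupport (K + 2)
  choose Mc hMc0 hMc using hMc
  have hMS := fun p ↦ exists_forall_iteratedFDeriv_slab_le hT (hsymbs p) (fun s y hy ↦ symbC_eq_one (S := S) p s hy) K
  choose MS hMS0 hMS using hMS
  have hMB := fun p ↦ exists_forall_iteratedFDeriv_slab_le hT (hfirsts p) (fun s y hy ↦ firstC_eq_zero (𝔟 := 𝔟) p s hy) K
  choose MB hMB0 hMB using hMB
  set Mall : ℝ := ∑ p, (Mc p + MS p + MB p) + 1 with hMall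
  have hsum1 : ∀ p, Mc p + MS p + MB p ≤ ∑ p, (Mc p + MS p + MB p) := fun p ↦
    Finset.single_le_sum (f := fun p ↦ Mc p + MS p + MB p) (fun p _ ↦ by linarith [hMc0 p, hMS0 p, hMB0 p]) (Finset.mem_univ p)
  have hMall1 : 1 ≤ Mall := le_add_of_nonneg_left (Finset.sum_nonneg fun p _ ↦ by linarith [hMc0 p, hMS0 p, hMB0 p])
  have hMcle : ∀ p, Mc p ≤ Mall := fun p ↦ by have := hsum1 p; rw [hMall]; linarith [hMS0 p, hMB0 p]
  have hMSle : ∀ p, MS p ≤ Mall := fun p ↦ by have := hsum1 p; rw [hMall]; linarith [hMc0 p, hMB0 p]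
  have hMBle : ∀ p, MB p ≤ Mall := fun p ↦ by have := hsum1 p; rw [hMall]; linarith [hMc0 p, hMS0 p]
  have hcomm := fun k ↦ sobolevEnergy_commOp_le (E' := E') (F' := F') k Mall
  choose Ccomm hCcommtop hCcomm using hcomm
  have hcr := fun k ↦ sobolevEnergy_smul_le_crude (E := E') (F := F') k
  choose Ccr hCcrtop hCcr using hcr
  have hcutw : ∀ p k, k ≤ K → (∀ y, |P.cut p y| ≤ Mall) ∧ ∀ l : List (Fin (Module.finrank ℝ E')), l ≠ [] → l.length ≤ k →
      ∀ y, ‖iterDirDeriv (l.map (stdOrthonormalBasis ℝ E')) (P.cut p) y‖ ≤ Mall := by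
    intro p k hk
    obtain ⟨h0, hw⟩ := norm_and_words_le_of_iteratedFDeriv_le (P.cut p).contDiff (k := k)
      (fun j hj y ↦ (hMc p y j (by omega)).trans (hMcle p))
    exact ⟨fun y ↦ by rw [← Real.norm_eq_abs]; exact h0 y, hw⟩
  set nn : ℝ≥0∞ := (Fintype.card ι : ℝ≥0∞) with hnn
  set Ctrk : ℕ → ℝ≥0∞ := fun k ↦ ∑ q, ∑ p, Ctr q p k with hCtrk
  have hCtrktop : ∀ k, Ctrk k ≠ ⊤ := fun k ↦ ENNReal.sum_ne_top.2 fun q _ ↦ ENNReal.sum_ne_top.2 fun p _ ↦ hCtrtop q p k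
  have hCtrle : ∀ q p k, Ctr q p k ≤ Ctrk k := fun q p k ↦
    (Finset.single_le_sum (f := fun p ↦ Ctr q p k) (fun _ _ ↦ bot_le) (Finset.mem_univ p)).trans
      (Finset.single_le_sum (f := fun q ↦ ∑ p, Ctr q p k) (fun _ _ ↦ bot_le) (Finset.mem_univ q))
  set Cir : ℝ≥0∞ := ∑ k ∈ Finset.range (K + 1), nn * Ctrk k * (Ccr k * ENNReal.ofReal (Mall ^ 2)) with hCir
  set CD : ℝ≥0∞ := ∑ k ∈ Finset.range (K + 1), nn * Ctrk k * Ccomm k * Cbox with hCD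
  set CDsup : ℝ≥0∞ := ∑ k ∈ Finset.range (K + 1), nn * Ctrk k * Ccomm k * Csup with hCDsup
  have hnntop : nn ≠ ⊤ := ENNReal.natCast_ne_top _
  refine ⟨Cir, CD, CDsup, ?_, ?_, ?_, ?_⟩
  · exact ENNReal.sum_ne_top.2 fun k _ ↦ ENNReal.mul_ne_top (ENNReal.mul_ne_top hnntop (hCtrktop k))
      (ENNReal.mul_ne_top (hCcrtop k) ENNReal.ofReal_ne_top)
  · exact ENNReal.sum_ne_top.2 fun k _ ↦ ENNReal.mul_ne_top (ENNReal.mul_ne_top (ENNReal.mul_ne_top hnntop (hCtrktop k))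
      (hCcommtop k)) hCboxtop
  · exact ENNReal.sum_ne_top.2 fun k _ ↦ ENNReal.mul_ne_top (ENNReal.mul_ne_top (ENNReal.mul_ne_top hnntop (hCtrktop k))
      (hCcommtop k)) hCsuptop
  intro Θ hΘ ε' hε'
  /- ## the localised sources and the local solutions -/
  have hΘfs : ∀ p, IsSmoothSpaceTimeOn (Icc 0 T) (fun s y ↦ rhoExpr P p (Θ s) y) := fun p ↦ contDiffOn_slab_rhoExpr P p (hΘ p)
  have hΘfsupp : ∀ p, ∀ s y, rhoExpr P p (Θ s) y ≠ 0 → y ∈ closedBall (0 : E') (2 * P.r p) :=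
    fun p s y h ↦ by by_contra hy; exact h (rhoExpr_eq_zero P p (Θ s) hy)
  have hb := fun p ↦ hbox p (hΘfs p) (hΘfsupp p) hε'
  choose v r hv hr hv0 hpde hsmall hgain hsupb using hb
  have hcut3 : ∀ p, tsupport (P.cut p) ⊆ closedBall (0 : E') (3 * P.r p) := fun p ↦ by
    rw [ContDiffBump.tsupport_eq, PatchSystem.cut_rOut]
  -- the commutators
  obtain ⟨Kc, hKc⟩ : ∃ Kc : ι → ℝ → E' → F',
      Kc = fun p s y ↦ commOp (symbC P p S s y) (firstC P p 𝔟 s y) (zeroC P p 𝔠 s y) (P.cut p) (v p s) y := ⟨_, rfl⟩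
  have hKcs : ∀ p, IsSmoothSpaceTimeOn (Icc 0 T) (Kc p) := fun p ↦ by
    rw [hKc]; exact isSmoothSpaceTimeOn_commOp hT (hsymbs p) (hfirsts p) (hzeros p) (P.cut p).contDiff (hv p)
  have hKcsupp : ∀ p s, tsupport (Kc p s) ⊆ tsupport (P.cut p) := fun p s ↦ by
    rw [hKc]; exact tsupport_commOp_subset _ _ _ _ _
  have hKcsupp' : ∀ p s y, Kc p s y ≠ 0 → y ∈ tsupport (P.cut p) := fun p s y h ↦ hKcsupp p s (subset_tsupport _ h)
  -- the glued objects
  obtain ⟨V, hVdef⟩ : ∃ V : ℝ → M → F', V = fun s x ↦ ∑ p, (P.chart p).globalize (fun y ↦ P.cut p y • v p s y) x := ⟨_, rfl⟩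
  obtain ⟨ir, hirdef⟩ : ∃ ir : ℝ → M → F', ir = fun s x ↦ ∑ p, (P.chart p).globalize (fun y ↦ P.cut p y • r p s y) x := ⟨_, rfl⟩
  obtain ⟨D, hDdef⟩ : ∃ D : ℝ → M → F', D = fun s x ↦ ∑ p, (P.chart p).globalize (Kc p s) x := ⟨_, rfl⟩
  /- ## chart-slab-smoothness -/
  have hglob_v : ∀ p q, ContDiffOn ℝ ∞ (uncurry fun s y ↦ (P.chart p).globalize (fun y ↦ P.cut p y • v p s y) ((P.chart q).inv y))
      (Icc 0 T ×ˢ (P.chart q).target) := fun p q ↦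
    SlabGlue.contDiffOn_slab_globalize_comp_inv (P.chart p) (P.chart q) (g := fun s y ↦ P.cut p y • v p s y)
      (ContDiffOn.mono ((isSmoothSpaceTimeOn_const_time (P.cut p).contDiff _).smul (hv p)) (Set.prod_mono le_rfl (subset_univ _)))
      (isCompact_closedBall 0 (3 * P.r p)) (P.closedBall_subset_target p (by norm_num))
      (fun s ↦ (tsupport_smul_subset_left _ _).trans (hcut3 p))
  have hglob_r : ∀ p q, ContDiffOn ℝ ∞ (uncurry fun s y ↦ (P.chart p).globalize (fun y ↦ P.cut p y • r p s y) ((P.chart q).inv y))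
      (Icc 0 T ×ˢ (P.chart q).target) := fun p q ↦
    SlabGlue.contDiffOn_slab_globalize_comp_inv (P.chart p) (P.chart q) (g := fun s y ↦ P.cut p y • r p s y)
      (ContDiffOn.mono ((isSmoothSpaceTimeOn_const_time (P.cut p).contDiff _).smul (hr p)) (Set.prod_mono le_rfl (subset_univ _)))
      (isCompact_closedBall 0 (3 * P.r p)) (P.closedBall_subset_target p (by norm_num))
      (fun s ↦ (tsupport_smul_subset_left _ _).trans (hcut3 p))
  have hglob_K : ∀ p q, ContDiffOn ℝ ∞ (uncurry fun s y ↦ (P.chart p).globalize (Kc p s) ((P.chart q).inv y))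
      (Icc 0 T ×ˢ (P.chart q).target) := fun p q ↦
    SlabGlue.contDiffOn_slab_globalize_comp_inv (P.chart p) (P.chart q) (ContDiffOn.mono (hKcs p) (Set.prod_mono le_rfl (subset_univ _)))
      (isCompact_closedBall 0 (3 * P.r p)) (P.closedBall_subset_target p (by norm_num)) (fun s ↦ (hKcsupp p s).trans (hcut3 p))
  have hVs : ∀ q, ContDiffOn ℝ ∞ (uncurry fun s y ↦ V s ((P.chart q).inv y)) (Icc 0 T ×ˢ (P.chart q).target) := fun q ↦ by
    rw [hVdef]; exact SlabGlue.contDiffOn_slab_sum Finset.univ fun p _ ↦ hglob_v p q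
  have hirs : ∀ q, ContDiffOn ℝ ∞ (uncurry fun s y ↦ ir s ((P.chart q).inv y)) (Icc 0 T ×ˢ (P.chart q).target) := fun q ↦ by
    rw [hirdef]; exact SlabGlue.contDiffOn_slab_sum Finset.univ fun p _ ↦ hglob_r p q
  have hDs : ∀ q, ContDiffOn ℝ ∞ (uncurry fun s y ↦ D s ((P.chart q).inv y)) (Icc 0 T ×ˢ (P.chart q).target) := fun q ↦ by
    rw [hDdef]; exact SlabGlue.contDiffOn_slab_sum Finset.univ fun p _ ↦ hglob_K p q
  /- ## initial value -/
  have hV0 : ∀ x, V 0 x = 0 := fun x ↦ by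
    rw [hVdef]
    refine Finset.sum_eq_zero fun p _ ↦ ?_
    have : (fun y ↦ P.cut p y • v p 0 y) = fun _ ↦ (0 : F') := funext fun y ↦ by rw [hv0 p y, smul_zero]
    rw [this]
    exact globalize_zero_fun _ x
  /- ## the equation -/
  have hident : ∀ s ∈ Icc 0 T, ∀ x, derivWithin (fun s ↦ V s x) (Icc 0 T) s = L s (V s) x + Θ s x - ir s x - D s x := by
    intro s hs x
    have hvsl : ∀ p, ContDiff ℝ ∞ (v p s) := fun p ↦ (hv p).contDiff_slice hs
    have hd : ∀ p, DifferentiableWithinAt ℝ (fun s ↦ (P.chart p).globalize (fun y ↦ P.cut p y • v p s y) x) (Icc 0 T) s :=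
      fun p ↦ differentiableWithinAt_globalize _ (fun y ↦ ((hv p).differentiableWithinAt_time hs y).const_smul _) x
    have h1 : derivWithin (fun s ↦ V s x) (Icc 0 T) s =
        ∑ p, derivWithin (fun s ↦ (P.chart p).globalize (fun y ↦ P.cut p y • v p s y) x) (Icc 0 T) s := by
      rw [hVdef]; exact derivWithin_fun_sum fun p _ ↦ hd p
    have h2 : ∀ p, derivWithin (fun s ↦ (P.chart p).globalize (fun y ↦ P.cut p y • v p s y) x) (Icc 0 T) s =
        (P.chart p).globalize (fun y ↦ P.cut p y • timeDerivWithin (Icc 0 T) (v p) s y) x := by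
      intro p
      rw [SlabGlue.derivWithin_globalize]
      congr 1
      funext y
      simp only [timeDerivWithin_apply]
      exact (((hv p).differentiableWithinAt_time hs y).hasDerivWithinAt.const_smul (P.cut p y)).derivWithin
        (uniqueDiffOn_Icc hT s hs)
    have h3 : ∀ p, (fun y ↦ P.cut p y • timeDerivWithin (Icc 0 T) (v p) s y) = fun y ↦
        (frameOp (symbC P p S s y) (firstC P p 𝔟 s y) (zeroC P p 𝔠 s y) (fun z ↦ P.cut p z • v p s z) y - Kc p s y) +
          rhoExpr P p (Θ s) y - P.cut p y • r p s y := by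
      intro p; funext y
      rw [hpde p s hs y, hKc]
      simp only [commOp_apply]
      rw [smul_sub, smul_add, cut_smul_rhoExpr, sub_sub_cancel]
    have h4 : ∀ p, (P.chart p).globalize (fun y ↦ P.cut p y • timeDerivWithin (Icc 0 T) (v p) s y) x =
        L s ((P.chart p).globalize fun y ↦ P.cut p y • v p s y) x - (P.chart p).globalize (Kc p s) x +
          (P.chart p).globalize (rhoExpr P p (Θ s)) x - (P.chart p).globalize (fun y ↦ P.cut p y • r p s y) x := by
      intro p
      rw [h3 p, globalize_sub, globalize_add, globalize_sub, op_globalize_cut_smul hL hs p (hvsl p) x]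
    have h5 : L s (V s) x = ∑ p, L s ((P.chart p).globalize fun y ↦ P.cut p y • v p s y) x := by
      rw [hVdef]
      exact op_sum hL hs (u := fun p ↦ (P.chart p).globalize fun y ↦ P.cut p y • v p s y)
        (fun p q ↦ contDiffOn_globalize_cut_smul_comp_inv p q (hvsl p)) x
    have h6 : ir s x = ∑ p, (P.chart p).globalize (fun y ↦ P.cut p y • r p s y) x := by rw [hirdef]
    have h7 : D s x = ∑ p, (P.chart p).globalize (Kc p s) x := by rw [hDdef]
    rw [h1, Finset.sum_congr rfl fun p _ ↦ (h2 p).trans (h4 p), Finset.sum_sub_distrib, Finset.sum_add_distrib,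
      Finset.sum_sub_distrib, ← h5, ← h6, ← h7, sum_globalize_rhoExpr]
    abel
  /- ## the inner residuals -/
  have hir_bound : ∀ k, k + 1 ≤ K → ∀ s ∈ Icc 0 T, ∀ q, sobolevEnergy k (rhoExpr P q (ir s)) ≤ Cir * ENNReal.ofReal ε' := by
    intro k hk s hs q
    have hkK : k ≤ K := by omega
    have hrsl : ∀ p, ContDiff ℝ ∞ (r p s) := fun p ↦ (hr p).contDiff_slice hs
    have hg : ∀ p, ContDiff ℝ ∞ fun y ↦ P.cut p y • r p s y := fun p ↦ (P.cut p).contDiff.smul (hrsl p)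
    have hgsupp : ∀ p y, P.cut p y • r p s y ≠ 0 → y ∈ tsupport (P.cut p) := fun p y h ↦
      subset_tsupport _ (left_ne_zero_of_smul h)
    have heq : rhoExpr P q (ir s) = fun y ↦ ∑ p, rhoExpr P q ((P.chart p).globalize fun y ↦ P.cut p y • r p s y) y := by
      funext y; rw [hirdef]; exact rhoExpr_sum q Finset.univ _ y
    have hterm : ∀ p, sobolevEnergy k (rhoExpr P q ((P.chart p).globalize fun y ↦ P.cut p y • r p s y)) ≤
        Ctr q p k * (Ccr k * ENNReal.ofReal (Mall ^ 2) * ENNReal.ofReal ε') := by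
      intro p
      calc _ ≤ Ctr q p k * sobolevEnergy k (fun y ↦ P.cut p y • r p s y) := hCtr q p k (hg p) (hgsupp p)
        _ ≤ Ctr q p k * (Ccr k * ENNReal.ofReal (Mall ^ 2) * sobolevEnergy k (r p s)) :=
            mul_le_mul' le_rfl (hCcr k (P.cut p).contDiff (hrsl p) (hcutw p k hkK).1 (hcutw p k hkK).2)
        _ ≤ _ := mul_le_mul' le_rfl (mul_le_mul' le_rfl (hsmall p k hk s hs))
    have hsmq : ∀ p, ContDiff ℝ k (rhoExpr P q ((P.chart p).globalize fun y ↦ P.cut p y • r p s y)) := fun p ↦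
      (contDiff_rhoExpr P q (contDiffOn_globalize_cut_smul_comp_inv p q (hrsl p))).of_le (by exact_mod_cast le_top)
    have hCirk : nn * Ctrk k * (Ccr k * ENNReal.ofReal (Mall ^ 2)) ≤ Cir :=
      Finset.single_le_sum (f := fun k ↦ nn * Ctrk k * (Ccr k * ENNReal.ofReal (Mall ^ 2))) (fun _ _ ↦ bot_le)
        (Finset.mem_range.2 (Nat.lt_succ_of_le hkK))
    rw [heq]
    calc _ ≤ nn * ∑ p, sobolevEnergy k (rhoExpr P q ((P.chart p).globalize fun y ↦ P.cut p y • r p s y)) := by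
          have h := sobolevEnergy_sum_le_card k Finset.univ (fun p _ ↦ hsmq p); rwa [Finset.card_univ] at h
      _ ≤ nn * ∑ p, Ctr q p k * (Ccr k * ENNReal.ofReal (Mall ^ 2) * ENNReal.ofReal ε') :=
          mul_le_mul' le_rfl (Finset.sum_le_sum fun p _ ↦ hterm p)
      _ = nn * (∑ p, Ctr q p k) * (Ccr k * ENNReal.ofReal (Mall ^ 2)) * ENNReal.ofReal ε' := by
          rw [← Finset.sum_mul]; ring
      _ ≤ nn * Ctrk k * (Ccr k * ENNReal.ofReal (Mall ^ 2)) * ENNReal.ofReal ε' := by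
          gcongr
          exact Finset.single_le_sum (f := fun q ↦ ∑ p, Ctr q p k) (fun _ _ ↦ bot_le) (Finset.mem_univ q)
      _ ≤ Cir * ENNReal.ofReal ε' := mul_le_mul' hCirk le_rfl
  /- ## the commutator source: pointwise in time -/
  have hD_pt : ∀ k ≤ K, ∀ s ∈ Icc 0 T, ∀ q, sobolevEnergy k (rhoExpr P q (D s)) ≤
      nn * ∑ p, Ctr q p k * (Ccomm k * ((∑ a, sobolevEnergy k (fun y ↦ fderiv ℝ (v p s) y (stdOrthonormalBasis ℝ E' a))) +
        sobolevEnergy k (v p s))) := by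
    intro k hk s hs q
    have hvsl : ∀ p, ContDiff ℝ ∞ (v p s) := fun p ↦ (hv p).contDiff_slice hs
    have hKsl : ∀ p, ContDiff ℝ ∞ (Kc p s) := fun p ↦ (hKcs p).contDiff_slice hs
    have heq : rhoExpr P q (D s) = fun y ↦ ∑ p, rhoExpr P q ((P.chart p).globalize (Kc p s)) y := by
      funext y; rw [hDdef]; exact rhoExpr_sum q Finset.univ _ y
    have hsmq : ∀ p, ContDiff ℝ k (rhoExpr P q ((P.chart p).globalize (Kc p s))) := fun p ↦
      (contDiff_rhoExpr P q ((P.chart p).contDiffOn_globalize_comp_inv (P.chart q) (hKsl p).contDiffOn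
        (isCompact_closedBall 0 (3 * P.r p)) (P.closedBall_subset_target p (by norm_num)) ((hKcsupp p s).trans (hcut3 p)))).of_le
        (by exact_mod_cast le_top)
    have hterm : ∀ p, sobolevEnergy k (rhoExpr P q ((P.chart p).globalize (Kc p s))) ≤
        Ctr q p k * (Ccomm k * ((∑ a, sobolevEnergy k (fun y ↦ fderiv ℝ (v p s) y (stdOrthonormalBasis ℝ E' a))) +
          sobolevEnergy k (v p s))) := by
      intro p
      refine (hCtr q p k (hKsl p) (hKcsupp' p s)).trans (mul_le_mul' le_rfl ?_)
      rw [hKc]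
      exact hCcomm k (𝔠₀ := fun y ↦ zeroC P p 𝔠 s y) ((hsymbs p).contDiff_slice hs) ((hfirsts p).contDiff_slice hs)
        (P.cut p).contDiff (hvsl p) (fun m hm y ↦ (hMS p s hs m (hm.trans hk) y).trans (hMSle p))
        (fun m hm y ↦ (hMB p s hs m (hm.trans hk) y).trans (hMBle p)) (fun m hm y ↦ (hMc p y m (by omega)).trans (hMcle p))
    rw [heq]
    calc _ ≤ nn * ∑ p, sobolevEnergy k (rhoExpr P q ((P.chart p).globalize (Kc p s))) := by
          have h := sobolevEnergy_sum_le_card k Finset.univ (fun p _ ↦ hsmq p); rwa [Finset.card_univ] at h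
      _ ≤ _ := mul_le_mul' le_rfl (Finset.sum_le_sum fun p _ ↦ hterm p)
  /- ## the commutator source: the weighted bound with gain -/
  have hWm : ∀ lam : ℝ, Measurable ((fun (lam s : ℝ) ↦ ENNReal.ofReal (Real.exp (-2 * lam * s))) lam) := fun lam ↦
    (Real.continuous_exp.comp (continuous_const.mul continuous_id)).measurable.ennreal_ofReal
  have hD_int : ∀ {lam : ℝ}, Λb ≤ lam → ∀ k ≤ K, ∀ t ∈ Icc 0 T,
      ∑ q, ∫⁻ s in Ioo 0 t, (fun (lam s : ℝ) ↦ ENNReal.ofReal (Real.exp (-2 * lam * s))) lam s * sobolevEnergy k (rhoExpr P q (D s)) ≤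
        CD * ENNReal.ofReal lam⁻¹ * ∑ p, ∫⁻ s in Ioo 0 t, (fun (lam s : ℝ) ↦ ENNReal.ofReal (Real.exp (-2 * lam * s))) lam s * sobolevEnergy k (rhoExpr P p (Θ s)) := by
    intro lam hlam k hk t ht
    set G : ι → ℝ → ℝ≥0∞ := fun p s ↦ (∑ a, sobolevEnergy k (fun y ↦ fderiv ℝ (v p s) y (stdOrthonormalBasis ℝ E' a))) +
      sobolevEnergy k (v p s) with hG
    set Y : ℝ≥0∞ := ∑ p, ∫⁻ s in Ioo 0 t, (fun (lam s : ℝ) ↦ ENNReal.ofReal (Real.exp (-2 * lam * s))) lam s * sobolevEnergy k (rhoExpr P p (Θ s)) with hY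
    have mG : ∀ p, AEMeasurable (fun s ↦ (fun (lam s : ℝ) ↦ ENNReal.ofReal (Real.exp (-2 * lam * s))) lam s * G p s) (volume.restrict (Ioo 0 t)) := by
      intro p
      refine (hWm lam).aemeasurable.mul ((Finset.aemeasurable_fun_sum _ fun a _ ↦ ?_).add
        (aemeasurable_sobolevEnergy_slice_Ioo' (hv p) k ht.2))
      exact aemeasurable_sobolevEnergy_slice_Ioo' (isSmoothSpaceTimeOn_fderiv_apply_Icc hT (hv p) _) k ht.2
    have hq : ∀ q, ∫⁻ s in Ioo 0 t, (fun (lam s : ℝ) ↦ ENNReal.ofReal (Real.exp (-2 * lam * s))) lam s * sobolevEnergy k (rhoExpr P q (D s)) ≤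
        nn * ∑ p, Ctr q p k * Ccomm k * ∫⁻ s in Ioo 0 t, (fun (lam s : ℝ) ↦ ENNReal.ofReal (Real.exp (-2 * lam * s))) lam s * G p s := by
      intro q
      calc _ ≤ ∫⁻ s in Ioo 0 t, (fun (lam s : ℝ) ↦ ENNReal.ofReal (Real.exp (-2 * lam * s))) lam s * (nn * ∑ p, Ctr q p k * (Ccomm k * G p s)) :=
            setLIntegral_mono' measurableSet_Ioo fun s hs' ↦ mul_le_mul' le_rfl (hD_pt k hk s ⟨hs'.1.le, hs'.2.le.trans ht.2⟩ q)
        _ = ∫⁻ s in Ioo 0 t, ∑ p, (nn * (Ctr q p k * Ccomm k)) * ((fun (lam s : ℝ) ↦ ENNReal.ofReal (Real.exp (-2 * lam * s))) lam s * G p s) := by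
            refine lintegral_congr fun s ↦ ?_
            rw [Finset.mul_sum, Finset.mul_sum]
            exact Finset.sum_congr rfl fun p _ ↦ by ring
        _ = ∑ p, (nn * (Ctr q p k * Ccomm k)) * ∫⁻ s in Ioo 0 t, (fun (lam s : ℝ) ↦ ENNReal.ofReal (Real.exp (-2 * lam * s))) lam s * G p s := by
            rw [lintegral_finsetSum' _ fun p _ ↦ (mG p).const_mul _]
            exact Finset.sum_congr rfl fun p _ ↦ lintegral_const_mul'' _ (mG p)
        _ = _ := by rw [Finset.mul_sum]; exact Finset.sum_congr rfl fun p _ ↦ by ring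
    have hg' : ∀ p, ∫⁻ s in Ioo 0 t, (fun (lam s : ℝ) ↦ ENNReal.ofReal (Real.exp (-2 * lam * s))) lam s * G p s ≤ Cbox * ENNReal.ofReal lam⁻¹ * Y := fun p ↦
      (hgain p hlam k hk t ht).trans (mul_le_mul' le_rfl (Finset.single_le_sum
        (f := fun p ↦ ∫⁻ s in Ioo 0 t, (fun (lam s : ℝ) ↦ ENNReal.ofReal (Real.exp (-2 * lam * s))) lam s * sobolevEnergy k (rhoExpr P p (Θ s))) (fun _ _ ↦ bot_le) (Finset.mem_univ p)))
    have hCDk : nn * Ctrk k * Ccomm k * Cbox ≤ CD :=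
      Finset.single_le_sum (f := fun k ↦ nn * Ctrk k * Ccomm k * Cbox) (fun _ _ ↦ bot_le) (Finset.mem_range.2 (Nat.lt_succ_of_le hk))
    clear_value Y
    calc ∑ q, ∫⁻ s in Ioo 0 t, (fun (lam s : ℝ) ↦ ENNReal.ofReal (Real.exp (-2 * lam * s))) lam s * sobolevEnergy k (rhoExpr P q (D s))
        ≤ ∑ q, nn * ∑ p, Ctr q p k * Ccomm k * ∫⁻ s in Ioo 0 t, (fun (lam s : ℝ) ↦ ENNReal.ofReal (Real.exp (-2 * lam * s))) lam s * G p s := Finset.sum_le_sum fun q _ ↦ hq q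
      _ ≤ ∑ q, nn * ∑ p, Ctr q p k * Ccomm k * (Cbox * ENNReal.ofReal lam⁻¹ * Y) := by
          gcongr with q _ p _
          exact hg' p
      _ = (nn * Ccomm k * (Cbox * ENNReal.ofReal lam⁻¹ * Y)) * ∑ q, ∑ p, Ctr q p k := by
          simp only [Finset.mul_sum]
          exact Finset.sum_congr rfl fun q _ ↦ Finset.sum_congr rfl fun p _ ↦ by ring
      _ = nn * Ctrk k * Ccomm k * Cbox * ENNReal.ofReal lam⁻¹ * Y := by simp only [hCtrk]; ring
      _ ≤ CD * ENNReal.ofReal lam⁻¹ * Y := by gcongr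
  /- ## the commutator source: pointwise bound -/
  have hD_sup : ∀ {lam : ℝ}, Λb ≤ lam → ∀ k ≤ K, ∀ s ∈ Icc 0 T, ∀ q,
      sobolevEnergy k (rhoExpr P q (D s)) ≤ CDsup * ENNReal.ofReal (Real.exp (2 * lam * s)) *
        ∑ p, ∫⁻ σ in Ioo 0 s, (fun (lam s : ℝ) ↦ ENNReal.ofReal (Real.exp (-2 * lam * s))) lam σ * sobolevEnergy k (rhoExpr P p (Θ σ)) := by
    intro lam hlam k hk s hs q
    set X : ℝ≥0∞ := ENNReal.ofReal (Real.exp (2 * lam * s)) with hX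
    set Y : ℝ≥0∞ := ∑ p, ∫⁻ σ in Ioo 0 s, (fun (lam s : ℝ) ↦ ENNReal.ofReal (Real.exp (-2 * lam * s))) lam σ * sobolevEnergy k (rhoExpr P p (Θ σ)) with hY
    have hg' : ∀ p, (∑ a, sobolevEnergy k (fun y ↦ fderiv ℝ (v p s) y (stdOrthonormalBasis ℝ E' a))) + sobolevEnergy k (v p s) ≤
        Csup * X * Y := fun p ↦
      (hsupb p hlam k hk s hs).trans (mul_le_mul' le_rfl (Finset.single_le_sum
        (f := fun p ↦ ∫⁻ σ in Ioo 0 s, (fun (lam s : ℝ) ↦ ENNReal.ofReal (Real.exp (-2 * lam * s))) lam σ * sobolevEnergy k (rhoExpr P p (Θ σ))) (fun _ _ ↦ bot_le) (Finset.mem_univ p)))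
    have hCDk : nn * Ctrk k * Ccomm k * Csup ≤ CDsup :=
      Finset.single_le_sum (f := fun k ↦ nn * Ctrk k * Ccomm k * Csup) (fun _ _ ↦ bot_le) (Finset.mem_range.2 (Nat.lt_succ_of_le hk))
    clear_value X Y
    calc sobolevEnergy k (rhoExpr P q (D s))
        ≤ nn * ∑ p, Ctr q p k * (Ccomm k * ((∑ a, sobolevEnergy k (fun y ↦ fderiv ℝ (v p s) y (stdOrthonormalBasis ℝ E' a))) +
            sobolevEnergy k (v p s))) := hD_pt k hk s hs q
      _ ≤ nn * ∑ p, Ctr q p k * (Ccomm k * (Csup * X * Y)) := by gcongr with p _; exact hg' p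
      _ = (nn * Ccomm k * (Csup * X * Y)) * ∑ p, Ctr q p k := by
          simp only [Finset.mul_sum]
          exact Finset.sum_congr rfl fun p _ ↦ by ring
      _ ≤ (nn * Ccomm k * (Csup * X * Y)) * Ctrk k :=
          mul_le_mul' le_rfl (Finset.single_le_sum (f := fun q ↦ ∑ p, Ctr q p k) (fun _ _ ↦ bot_le) (Finset.mem_univ q))
      _ = nn * Ctrk k * Ccomm k * Csup * X * Y := by simp only [hCtrk]; ring
      _ ≤ CDsup * X * Y := by gcongr
  exact ⟨V, ir, D, hVs, hirs, hDs, hV0, hident, hir_bound, hD_int, hD_sup⟩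

end Step

/-! ### The outer iteration and the main theorem -/

section Main

variable {P} [IsManifold I ∞ M] [I.Boundaryless] [T2Space M] [MeasurableSpace E'] [BorelSpace E']
  {S : ι → ℝ → E' → (E' →L[ℝ] E')} {𝔟 : ι → ℝ → E' → ((E' →L[ℝ] F') →L[ℝ] F')} {𝔠 : ι → ℝ → E' → (F' →L[ℝ] F')}
  {L : ℝ → (M → F') → M → F'}


omit [IsManifold I ∞ M] [T2Space M] [MeasurableSpace E'] [BorelSpace E'] in
/-- **A represented operator is additive** (two summands). [folklore] -/
theorem op_add
    (hL : ∀ s ∈ Icc 0 T, ∀ u : M → F', (∀ q, ContDiffOn ℝ ∞ (u ∘ (P.chart q).inv) (P.chart q).target) →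
      ∀ p, ∀ y ∈ (P.chart p).target, L s u ((P.chart p).inv y) = frameOp (S p s y) (𝔟 p s y) (𝔠 p s y) (u ∘ (P.chart p).inv) y)
    {s : ℝ} (hs : s ∈ Icc 0 T) {f g : M → F'} (hf : ∀ q, ContDiffOn ℝ ∞ (f ∘ (P.chart q).inv) (P.chart q).target)
    (hg : ∀ q, ContDiffOn ℝ ∞ (g ∘ (P.chart q).inv) (P.chart q).target) (x : M) :
    L s (fun x ↦ f x + g x) x = L s f x + L s g x := by
  have h := op_sum hL hs (u := ![f, g]) (fun i q ↦ by fin_cases i <;> simp [hf q, hg q]) x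
  simpa [Fin.sum_univ_two] using h

omit [IsManifold I ∞ M] [T2Space M] [MeasurableSpace E'] [BorelSpace E'] in
/-- **A represented operator annihilates the zero function.** [folklore] -/
theorem op_zero
    (hL : ∀ s ∈ Icc 0 T, ∀ u : M → F', (∀ q, ContDiffOn ℝ ∞ (u ∘ (P.chart q).inv) (P.chart q).target) →
      ∀ p, ∀ y ∈ (P.chart p).target, L s u ((P.chart p).inv y) = frameOp (S p s y) (𝔟 p s y) (𝔠 p s y) (u ∘ (P.chart p).inv) y)
    {s : ℝ} (hs : s ∈ Icc 0 T) (x : M) : L s (fun _ : M ↦ (0 : F')) x = 0 :=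
  op_eq_zero_of_eventuallyEq hL hs (fun _ ↦ contDiffOn_const) (Eventually.of_forall fun _ ↦ rfl)

omit [FiniteDimensional ℝ E'] [IsManifold I ∞ M] [I.Boundaryless] [T2Space M] [MeasurableSpace E'] [BorelSpace E'] in
/-- Time lines of a chart-slab-smooth field are differentiable within `[0, T]`. [folklore] -/
theorem differentiableWithinAt_time_of_charts {V : ℝ → M → F'}
    (hV : ∀ q, ContDiffOn ℝ ∞ (uncurry fun s y ↦ V s ((P.chart q).inv y)) (Icc 0 T ×ˢ (P.chart q).target))
    {s : ℝ} (hs : s ∈ Icc 0 T) (x : M) : DifferentiableWithinAt ℝ (fun s ↦ V s x) (Icc 0 T) s := by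
  obtain ⟨q, hxs, -⟩ := P.cover x
  have hy : (P.chart q).map x ∈ (P.chart q).target := (P.chart q).map_mem_target hxs
  have h1 : DifferentiableWithinAt ℝ (uncurry fun s y ↦ V s ((P.chart q).inv y)) (Icc 0 T ×ˢ (P.chart q).target)
      (s, (P.chart q).map x) := ((hV q) _ (mk_mem_prod hs hy)).differentiableWithinAt (by simp)
  have h2 : DifferentiableWithinAt ℝ (fun s : ℝ ↦ ((s, (P.chart q).map x) : ℝ × E')) (Icc 0 T) s :=
    differentiableWithinAt_id.prodMk (differentiableWithinAt_const _)
  have h := h1.comp s h2 (fun s' hs' ↦ mk_mem_prod hs' hy)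
  have heq : (uncurry fun s y ↦ V s ((P.chart q).inv y)) ∘ (fun s : ℝ ↦ ((s, (P.chart q).map x) : ℝ × E')) = fun s ↦ V s x := by
    funext s'; simp [(P.chart q).inv_map hxs]
  rwa [heq] at h

omit [FiniteDimensional ℝ E'] [IsManifold I ∞ M] [I.Boundaryless] [T2Space M] [MeasurableSpace E'] [BorelSpace E'] in
/-- Time slices of a chart-slab-smooth field have smooth chart expressions. [folklore] -/
theorem contDiffOn_slice_of_charts {V : ℝ → M → F'} {q : ι}
    (hV : ContDiffOn ℝ ∞ (uncurry fun s y ↦ V s ((P.chart q).inv y)) (Icc 0 T ×ˢ (P.chart q).target))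
    {s : ℝ} (hs : s ∈ Icc 0 T) : ContDiffOn ℝ ∞ (V s ∘ (P.chart q).inv) (P.chart q).target := by
  have h := hV.comp (contDiffOn_const.prodMk contDiffOn_id) (fun y hy ↦ mk_mem_prod hs hy)
  exact h

/-- **The number of steps from the tolerance**: `(1/2)^N G ≤ ε` for some `N` (`G` finite). [folklore] -/
theorem exists_inv_two_pow_mul_le {G : ℝ≥0∞} (hG : G ≠ ⊤) {ε : ℝ} (hε : 0 < ε) :
    ∃ N : ℕ, (2⁻¹ : ℝ≥0∞) ^ N * G ≤ ENNReal.ofReal ε := by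
  rcases eq_or_ne G 0 with hG0 | hG0
  · exact ⟨0, by simp [hG0]⟩
  have hpos : ENNReal.ofReal ε / G ≠ 0 := (ENNReal.div_pos (by simpa using hε) hG).ne'
  obtain ⟨N, hN⟩ := ENNReal.exists_inv_two_pow_lt hpos
  exact ⟨N, ((ENNReal.lt_div_iff_mul_lt (Or.inl hG0) (Or.inl hG)).1 hN).le⟩

set_option maxHeartbeats 1600000 in
/-- **Approximate solutions of a represented linear parabolic system on a closed manifold, with
arbitrarily small residual.** See the module docstring. The smallness hypothesis on the temporal
oscillation is `2 √C_n ε_o ≤ min 1 ν₀`, `C_n = 3840 n³ (10√n + 1)^{2n} n!`, `n = dim E'`.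
[cite: Hormander1985III, §17.1] -/
theorem exists_manifoldApproxSolve [Nontrivial E'] [FiniteDimensional ℝ F'] (hT : 0 < T)
    (hS : ∀ p, ContDiffOn ℝ ∞ (uncurry (S p)) (Icc 0 T ×ˢ (P.chart p).target))
    (h𝔟 : ∀ p, ContDiffOn ℝ ∞ (uncurry (𝔟 p)) (Icc 0 T ×ˢ (P.chart p).target))
    (h𝔠 : ∀ p, ContDiffOn ℝ ∞ (uncurry (𝔠 p)) (Icc 0 T ×ˢ (P.chart p).target))
    (hL : ∀ s ∈ Icc 0 T, ∀ u : M → F', (∀ q, ContDiffOn ℝ ∞ (u ∘ (P.chart q).inv) (P.chart q).target) →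
      ∀ p, ∀ y ∈ (P.chart p).target, L s u ((P.chart p).inv y) = frameOp (S p s y) (𝔟 p s y) (𝔠 p s y) (u ∘ (P.chart p).inv) y)
    (hsym : ∀ p, ∀ y ∈ closedBall (0 : E') (4 * P.r p), ContinuousLinearMap.adjoint (S p 0 y) = S p 0 y)
    {ν₀ : ℝ} (hν₀ : 0 < ν₀) (hcoer : ∀ p, ∀ y ∈ closedBall (0 : E') (4 * P.r p), ∀ ξ : E', ν₀ * ‖ξ‖ ^ 2 ≤ ⟪S p 0 y ξ, ξ⟫)
    {εo : ℝ} (hosc : ∀ p, ∀ s ∈ Icc 0 T, ∀ y ∈ closedBall (0 : E') (4 * P.r p), ‖S p s y - S p 0 y‖ ≤ εo)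
    (hεo : 2 * Real.sqrt (3840 * (Module.finrank ℝ E' : ℝ) ^ 3 *
      (10 * Real.sqrt (Module.finrank ℝ E') + 1) ^ (2 * Module.finrank ℝ E') * (Module.finrank ℝ E').factorial) * εo ≤ min 1 ν₀)
    (K : ℕ) {Θ : ℝ → M → F'}
    (hΘ : ∀ q, ContDiffOn ℝ ∞ (uncurry fun s y ↦ Θ s ((P.chart q).inv y)) (Icc 0 T ×ˢ (P.chart q).target))
    {ε : ℝ} (hε : 0 < ε) :
    ∃ v R : ℝ → M → F',
      (∀ q, ContDiffOn ℝ ∞ (uncurry fun s y ↦ v s ((P.chart q).inv y)) (Icc 0 T ×ˢ (P.chart q).target)) ∧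
      (∀ q, ContDiffOn ℝ ∞ (uncurry fun s y ↦ R s ((P.chart q).inv y)) (Icc 0 T ×ˢ (P.chart q).target)) ∧
      (∀ x, v 0 x = 0) ∧
      (∀ s ∈ Icc 0 T, ∀ x, derivWithin (fun s ↦ v s x) (Icc 0 T) s = L s (v s) x + Θ s x - R s x) ∧
      (∀ k, k + 1 ≤ K → ∀ s ∈ Icc 0 T, ∀ p, sobolevEnergy k (cutExpr P p (R s)) ≤ ENNReal.ofReal ε) := by
  classical
  haveI : CompleteSpace E' := FiniteDimensional.complete ℝ E'
  /- ## the approximate solution operators of the charts -/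
  have hεo0 : ι → 0 ≤ εo := fun p ↦ by
    have h := hosc p 0 ⟨le_rfl, hT.le⟩ 0 (mem_closedBall_self (by linarith [P.r_pos p]))
    rwa [sub_self, norm_zero] at h
  have hsymbs : ∀ p, IsSmoothSpaceTimeOn (Icc 0 T) (symbC P p S) := fun p ↦ isSmoothSpaceTimeOn_symbC p (hS p)
  have hfirsts : ∀ p, IsSmoothSpaceTimeOn (Icc 0 T) (firstC P p 𝔟) := fun p ↦ isSmoothSpaceTimeOn_firstC p (h𝔟 p)
  have hzeros : ∀ p, IsSmoothSpaceTimeOn (Icc 0 T) (zeroC P p 𝔠) := fun p ↦ isSmoothSpaceTimeOn_zeroC p (h𝔠 p)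
  have hb := fun p ↦ exists_flatApproxSolve (F' := F') hT (hsymbs p) (hfirsts p) (hzeros p) (Rc := 4 * P.r p)
    (fun s y hy ↦ symbC_eq_one (S := S) p s hy) (fun s y hy ↦ firstC_eq_zero (𝔟 := 𝔟) p s hy)
    (fun s y hy ↦ zeroC_eq_zero (𝔠 := 𝔠) p s hy) (adjoint_symbC_zero p (hsym p)) (lt_min one_pos hν₀)
    (coercive_symbC_zero p (hcoer p)) (fun s hs y ↦ norm_symbC_sub_le p (hosc p) (hεo0 p) hs y) hεo K (ϱ := 2 * P.r p)
    (by linarith [P.r_pos p])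
  choose Λ₀ hΛ₀1 Cbx Csx hCbxtop hCsxtop hbox using hb
  set Λb : ℝ := 1 + ∑ p, Λ₀ p with hΛb
  have hΛ₀le : ∀ p, Λ₀ p ≤ Λb := fun p ↦ by
    have h := Finset.single_le_sum (f := Λ₀) (fun p _ ↦ zero_le_one.trans (hΛ₀1 p)) (Finset.mem_univ p)
    rw [hΛb]; linarith
  set Cbox : ℝ≥0∞ := ∑ p, Cbx p with hCbox
  set Csup : ℝ≥0∞ := ∑ p, Csx p with hCsup
  have hCboxtop : Cbox ≠ ⊤ := ENNReal.sum_ne_top.2 fun p _ ↦ hCbxtop p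
  have hCsuptop : Csup ≠ ⊤ := ENNReal.sum_ne_top.2 fun p _ ↦ hCsxtop p
  have hCbxle : ∀ p, Cbx p ≤ Cbox := fun p ↦ Finset.single_le_sum (f := Cbx) (fun _ _ ↦ bot_le) (Finset.mem_univ p)
  have hCsxle : ∀ p, Csx p ≤ Csup := fun p ↦ Finset.single_le_sum (f := Csx) (fun _ _ ↦ bot_le) (Finset.mem_univ p)
  have hbox' : ∀ p, ∀ {Θf : ℝ → E' → F'}, IsSmoothSpaceTimeOn (Icc 0 T) Θf →
      (∀ s y, Θf s y ≠ 0 → y ∈ closedBall (0 : E') (2 * P.r p)) → ∀ {ε : ℝ}, 0 < ε → ∃ v r : ℝ → E' → F',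
      IsSmoothSpaceTimeOn (Icc 0 T) v ∧ IsSmoothSpaceTimeOn (Icc 0 T) r ∧ (∀ y, v 0 y = 0) ∧
      (∀ s ∈ Icc 0 T, ∀ y, timeDerivWithin (Icc 0 T) v s y =
        frameOp (symbC P p S s y) (firstC P p 𝔟 s y) (zeroC P p 𝔠 s y) (v s) y + Θf s y - r s y) ∧
      (∀ k, k + 1 ≤ K → ∀ s ∈ Icc 0 T, sobolevEnergy k (r s) ≤ ENNReal.ofReal ε) ∧
      (∀ {lam : ℝ}, Λb ≤ lam → ∀ k ≤ K, ∀ t ∈ Icc 0 T,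
        ∫⁻ s in Ioo 0 t, (fun (lam s : ℝ) ↦ ENNReal.ofReal (Real.exp (-2 * lam * s))) lam s * ((∑ a, sobolevEnergy k (fun y ↦ fderiv ℝ (v s) y (stdOrthonormalBasis ℝ E' a))) +
          sobolevEnergy k (v s)) ≤ Cbox * ENNReal.ofReal lam⁻¹ * ∫⁻ s in Ioo 0 t, (fun (lam s : ℝ) ↦ ENNReal.ofReal (Real.exp (-2 * lam * s))) lam s * sobolevEnergy k (Θf s)) ∧
      (∀ {lam : ℝ}, Λb ≤ lam → ∀ k ≤ K, ∀ s ∈ Icc 0 T,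
        (∑ a, sobolevEnergy k (fun y ↦ fderiv ℝ (v s) y (stdOrthonormalBasis ℝ E' a))) + sobolevEnergy k (v s) ≤
          Csup * ENNReal.ofReal (Real.exp (2 * lam * s)) * ∫⁻ σ in Ioo 0 s, (fun (lam s : ℝ) ↦ ENNReal.ofReal (Real.exp (-2 * lam * s))) lam σ * sobolevEnergy k (Θf σ)) := by
    intro p Θf hΘf hsupp ε' hε'
    obtain ⟨v, r, hv, hr, hv0, hpde, hsmall, hgain, hsupb⟩ := hbox p hΘf hsupp hε'
    refine ⟨v, r, hv, hr, hv0, hpde, hsmall, fun {lam} hlam k hk t ht ↦ ?_, fun {lam} hlam k hk s hs ↦ ?_⟩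
    · exact (hgain ((hΛ₀le p).trans hlam) k hk t ht).trans (mul_le_mul' (mul_le_mul' (hCbxle p) le_rfl) le_rfl)
    · exact (hsupb ((hΛ₀le p).trans hlam) k hk s hs).trans (mul_le_mul' (mul_le_mul' (hCsxle p) le_rfl) le_rfl)
  /- ## one outer step and the threshold -/
  obtain ⟨Cir, CD, CDsup, hCirtop, hCDtop, hCDsuptop, hstep⟩ :=
    outer_step (L := L) hT hS h𝔟 h𝔠 hL K hCboxtop hCsuptop hbox'
  set Λ : ℝ := max Λb ((CD.toReal + 1) / 2⁻¹) with hΛdef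
  have hΛb1 : 1 ≤ Λb := le_add_of_nonneg_right (Finset.sum_nonneg fun p _ ↦ zero_le_one.trans (hΛ₀1 p))
  have hΛ1 : 1 ≤ Λ := hΛb1.trans (le_max_left _ _)
  have hΛ0 : 0 < Λ := one_pos.trans_le hΛ1
  have hΛbΛ : Λb ≤ Λ := le_max_left _ _
  have hhalf : CD * ENNReal.ofReal Λ⁻¹ ≤ 2⁻¹ := by
    have h := FlatStep.mul_ofReal_inv_le_of_le hCDtop (c := 2⁻¹) (by norm_num) (le_max_right Λb _)
    rwa [ENNReal.ofReal_inv_of_pos two_pos, ENNReal.ofReal_ofNat] at h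
  -- the data norm at the weight `Λ`
  set NΘ : ℕ → ℝ → ℝ≥0∞ := fun k t ↦ ∑ p, ∫⁻ s in Ioo 0 t, (fun (lam s : ℝ) ↦ ENNReal.ofReal (Real.exp (-2 * lam * s))) Λ s * sobolevEnergy k (rhoExpr P p (Θ s)) with hNΘ
  /- ## the outer iteration -/
  have hiter : ∀ (ε' : ℝ), 0 < ε' → ∀ N : ℕ, ∃ V D : ℝ → M → F', ∃ irf : ℕ → ℝ → M → F',
      (∀ q, ContDiffOn ℝ ∞ (uncurry fun s y ↦ V s ((P.chart q).inv y)) (Icc 0 T ×ˢ (P.chart q).target)) ∧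
      (∀ q, ContDiffOn ℝ ∞ (uncurry fun s y ↦ D s ((P.chart q).inv y)) (Icc 0 T ×ˢ (P.chart q).target)) ∧
      (∀ m q, ContDiffOn ℝ ∞ (uncurry fun s y ↦ irf m s ((P.chart q).inv y)) (Icc 0 T ×ˢ (P.chart q).target)) ∧
      (∀ x, V 0 x = 0) ∧
      (∀ s ∈ Icc 0 T, ∀ x, derivWithin (fun s ↦ V s x) (Icc 0 T) s =
        L s (V s) x + Θ s x - (∑ m ∈ Finset.range N, irf m s x) - D s x) ∧
      (∀ m < N, ∀ k, k + 1 ≤ K → ∀ s ∈ Icc 0 T, ∀ q, sobolevEnergy k (rhoExpr P q (irf m s)) ≤ Cir * ENNReal.ofReal ε') ∧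
      (∀ k ≤ K, ∀ t ∈ Icc 0 T, ∑ p, ∫⁻ s in Ioo 0 t, (fun (lam s : ℝ) ↦ ENNReal.ofReal (Real.exp (-2 * lam * s))) Λ s * sobolevEnergy k (rhoExpr P p (D s)) ≤ (2⁻¹ : ℝ≥0∞) ^ N * NΘ k t) ∧
      (N ≠ 0 → ∀ k ≤ K, ∀ s ∈ Icc 0 T, ∀ q, sobolevEnergy k (rhoExpr P q (D s)) ≤
        CDsup * ENNReal.ofReal (Real.exp (2 * Λ * s)) * ((2⁻¹ : ℝ≥0∞) ^ (N - 1) * NΘ k s)) := by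
    intro ε' hε' N
    induction N with
    | zero =>
      refine ⟨fun _ _ ↦ 0, Θ, fun _ _ _ ↦ 0, fun q ↦ contDiffOn_const, hΘ, fun m q ↦ contDiffOn_const, fun x ↦ rfl, ?_, ?_, ?_, ?_⟩
      · intro s hs x
        simp [op_zero hL hs x]
      · intro m hm; exact absurd hm (Nat.not_lt_zero m)
      · intro k hk t ht; rw [pow_zero, one_mul]
      · intro h; exact absurd rfl h
    | succ N ih =>
      obtain ⟨V, D, irf, hVs, hDs, hirfs, hV0, hid, hirb, hcontr, hsupD⟩ := ih
      obtain ⟨V₁, ir₁, D₁, hV₁s, hir₁s, hD₁s, hV₁0, hid₁, hir₁b, hD₁int, hD₁sup⟩ := hstep hDs hε'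
      refine ⟨fun s x ↦ V s x + V₁ s x, D₁, Function.update irf N ir₁, ?_, hD₁s, ?_, ?_, ?_, ?_, ?_, ?_⟩
      · intro q
        exact (hVs q).add (hV₁s q)
      · intro m q
        by_cases hm : m = N
        · subst hm; simp only [Function.update_self]; exact hir₁s q
        · simp only [Function.update_of_ne hm]; exact hirfs m q
      · intro x; simp [hV0 x, hV₁0 x]
      · intro s hs x
        have hdV := differentiableWithinAt_time_of_charts hVs hs x
        have hdV₁ := differentiableWithinAt_time_of_charts hV₁s hs x
        have hsum : ∑ m ∈ Finset.range (N + 1), Function.update irf N ir₁ m s x = (∑ m ∈ Finset.range N, irf m s x) + ir₁ s x := by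
          rw [Finset.sum_range_succ, Function.update_self]
          congr 1
          exact Finset.sum_congr rfl fun m hm ↦ by rw [Function.update_of_ne (Finset.mem_range.1 hm).ne]
        rw [derivWithin_fun_add hdV hdV₁, hid s hs x, hid₁ s hs x, hsum,
          op_add hL hs (fun q ↦ ?_) (fun q ↦ ?_) x]
        · abel
        · exact contDiffOn_slice_of_charts (hVs q) hs
        · exact contDiffOn_slice_of_charts (hV₁s q) hs
      · intro m hm k hk s hs' q
        by_cases hmN : m = N
        · subst hmN; simp only [Function.update_self]; exact hir₁b k hk s hs' q
        · simp only [Function.update_of_ne hmN]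
          exact hirb m (by omega) k hk s hs' q
      · intro k hk t ht
        calc ∑ p, ∫⁻ s in Ioo 0 t, (fun (lam s : ℝ) ↦ ENNReal.ofReal (Real.exp (-2 * lam * s))) Λ s * sobolevEnergy k (rhoExpr P p (D₁ s))
            ≤ CD * ENNReal.ofReal Λ⁻¹ * ∑ p, ∫⁻ s in Ioo 0 t, (fun (lam s : ℝ) ↦ ENNReal.ofReal (Real.exp (-2 * lam * s))) Λ s * sobolevEnergy k (rhoExpr P p (D s)) := hD₁int hΛbΛ k hk t ht
          _ ≤ 2⁻¹ * ((2⁻¹ : ℝ≥0∞) ^ N * NΘ k t) := mul_le_mul' hhalf (hcontr k hk t ht)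
          _ = (2⁻¹ : ℝ≥0∞) ^ (N + 1) * NΘ k t := by rw [pow_succ]; ring
      · intro _ k hk s hs' q
        calc sobolevEnergy k (rhoExpr P q (D₁ s))
            ≤ CDsup * ENNReal.ofReal (Real.exp (2 * Λ * s)) * ∑ p, ∫⁻ σ in Ioo 0 s, (fun (lam s : ℝ) ↦ ENNReal.ofReal (Real.exp (-2 * lam * s))) Λ σ * sobolevEnergy k (rhoExpr P p (D σ)) :=
              hD₁sup hΛbΛ k hk s hs' q
          _ ≤ CDsup * ENNReal.ofReal (Real.exp (2 * Λ * s)) * ((2⁻¹ : ℝ≥0∞) ^ N * NΘ k s) :=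
              mul_le_mul' le_rfl (hcontr k hk s hs')
          _ = _ := by rw [Nat.add_sub_cancel]
  /- ## the transports back to the cut-off localisation, the number of steps and the tolerance -/
  have hcx := fun p k ↦ exists_cutExpr_le_sum_rhoExpr P (F := F') p k
  choose Ccx hCcxtop hCcx using hcx
  set Ccxs : ℝ≥0∞ := ∑ k ∈ Finset.range (K + 1), ∑ p, Ccx p k with hCcxs
  have hCcxstop : Ccxs ≠ ⊤ := ENNReal.sum_ne_top.2 fun k _ ↦ ENNReal.sum_ne_top.2 fun p _ ↦ hCcxtop p k
  have hCcxle : ∀ p, ∀ k ≤ K, Ccx p k ≤ Ccxs := fun p k hk ↦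
    (Finset.single_le_sum (f := fun p ↦ Ccx p k) (fun _ _ ↦ bot_le) (Finset.mem_univ p)).trans
      (Finset.single_le_sum (f := fun k ↦ ∑ p, Ccx p k) (fun _ _ ↦ bot_le) (Finset.mem_range.2 (Nat.lt_succ_of_le hk)))
  have hNΘtop : ∀ k, NΘ k T ≠ ⊤ := fun k ↦ ENNReal.sum_ne_top.2 fun p _ ↦
    lintegral_weight_sobolevEnergy_slab_ne_top hT (contDiffOn_slab_rhoExpr P p (hΘ p)) (isCompact_closedBall 0 (2 * P.r p))
      (fun s y hy ↦ rhoExpr_eq_zero P p (Θ s) hy) k hΛ0.le le_rfl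
  set NΘT : ℝ≥0∞ := ∑ k ∈ Finset.range (K + 1), NΘ k T with hNΘT
  have hNΘTtop : NΘT ≠ ⊤ := ENNReal.sum_ne_top.2 fun k _ ↦ hNΘtop k
  have hNΘle : ∀ k ≤ K, ∀ s ∈ Icc 0 T, NΘ k s ≤ NΘT := by
    intro k hk s hs
    refine le_trans ?_ (Finset.single_le_sum (f := fun k ↦ NΘ k T) (fun _ _ ↦ bot_le) (Finset.mem_range.2 (Nat.lt_succ_of_le hk)))
    exact Finset.sum_le_sum fun p _ ↦ lintegral_mono_set (Ioo_subset_Ioo le_rfl hs.2)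
  set XT : ℝ≥0∞ := ENNReal.ofReal (Real.exp (2 * Λ * T)) with hXT
  have hXle : ∀ s ∈ Icc 0 T, ENNReal.ofReal (Real.exp (2 * Λ * s)) ≤ XT := fun s hs ↦
    ENNReal.ofReal_le_ofReal (Real.exp_le_exp.2 (by nlinarith [hs.2, hΛ0.le]))
  set nn : ℝ≥0∞ := (Fintype.card ι : ℝ≥0∞) with hnn
  set Gfin : ℝ≥0∞ := Ccxs * (nn * (2 * (CDsup * XT * NΘT))) with hGfin
  have hGfintop : Gfin ≠ ⊤ := ENNReal.mul_ne_top hCcxstop (ENNReal.mul_ne_top (ENNReal.natCast_ne_top _)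
    (ENNReal.mul_ne_top (by norm_num) (ENNReal.mul_ne_top (ENNReal.mul_ne_top hCDsuptop ENNReal.ofReal_ne_top) hNΘTtop)))
  obtain ⟨N₀, hN₀⟩ := exists_inv_two_pow_mul_le hGfintop (half_pos hε)
  set N : ℕ := N₀ + 1 with hNdef
  set Hfin : ℝ≥0∞ := Ccxs * (nn * (2 * ((N : ℝ≥0∞) * ((N : ℝ≥0∞) * Cir)))) with hHfin
  have hHfintop : Hfin ≠ ⊤ := ENNReal.mul_ne_top hCcxstop (ENNReal.mul_ne_top (ENNReal.natCast_ne_top _)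
    (ENNReal.mul_ne_top (by norm_num) (ENNReal.mul_ne_top (ENNReal.natCast_ne_top _)
      (ENNReal.mul_ne_top (ENNReal.natCast_ne_top _) hCirtop))))
  set lam' : ℝ := (Hfin.toReal + 1) / (ε / 2) with hlam'
  have hlam'0 : 0 < lam' := by positivity
  have hH : Hfin * ENNReal.ofReal lam'⁻¹ ≤ ENNReal.ofReal (ε / 2) := FlatStep.mul_ofReal_inv_le_of_le hHfintop (half_pos hε) le_rfl
  obtain ⟨V, D, irf, hVs, hDs, hirfs, hV0, hid, hirb, hcontr, hsupD⟩ := hiter lam'⁻¹ (inv_pos.2 hlam'0) N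
  refine ⟨V, fun s x ↦ (∑ m ∈ Finset.range N, irf m s x) + D s x, hVs, ?_, hV0, ?_, ?_⟩
  · intro q
    exact (SlabGlue.contDiffOn_slab_sum (Finset.range N) fun m _ ↦ hirfs m q).add (hDs q)
  · intro s hs x
    rw [hid s hs x, sub_sub]
  · intro k hk s hs p
    have hkK : k ≤ K := by omega
    have hIRc : ∀ q, ContDiffOn ℝ ∞ ((fun x ↦ ∑ m ∈ Finset.range N, irf m s x) ∘ (P.chart q).inv) (P.chart q).target := by
      intro q
      have : ((fun x ↦ ∑ m ∈ Finset.range N, irf m s x) ∘ (P.chart q).inv) = fun y ↦ ∑ m ∈ Finset.range N, (irf m s ∘ (P.chart q).inv) y := by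
        funext y; simp
      rw [this]
      exact ContDiffOn.sum fun m _ ↦ contDiffOn_slice_of_charts (hirfs m q) hs
    have hDc : ∀ q, ContDiffOn ℝ ∞ (D s ∘ (P.chart q).inv) (P.chart q).target := fun q ↦ contDiffOn_slice_of_charts (hDs q) hs
    have hRc : ∀ q, ContDiffOn ℝ ∞ ((fun x ↦ (∑ m ∈ Finset.range N, irf m s x) + D s x) ∘ (P.chart q).inv) (P.chart q).target :=
      fun q ↦ (hIRc q).add (hDc q)
    -- the two pieces in each chart
    have hIRq : ∀ q, sobolevEnergy k (rhoExpr P q fun x ↦ ∑ m ∈ Finset.range N, irf m s x) ≤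
        (N : ℝ≥0∞) * ((N : ℝ≥0∞) * (Cir * ENNReal.ofReal lam'⁻¹)) := by
      intro q
      have heq : (rhoExpr P q fun x ↦ ∑ m ∈ Finset.range N, irf m s x) = fun y ↦ ∑ m ∈ Finset.range N, rhoExpr P q (irf m s) y :=
        funext fun y ↦ rhoExpr_sum q _ _ y
      have hsm : ∀ m ∈ Finset.range N, ContDiff ℝ k (rhoExpr P q (irf m s)) := fun m _ ↦
        (contDiff_rhoExpr P q (contDiffOn_slice_of_charts (hirfs m q) hs)).of_le (by exact_mod_cast le_top)
      rw [heq]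
      calc _ ≤ ((Finset.range N).card : ℝ≥0∞) * ∑ m ∈ Finset.range N, sobolevEnergy k (rhoExpr P q (irf m s)) :=
            sobolevEnergy_sum_le_card k _ hsm
        _ ≤ ((Finset.range N).card : ℝ≥0∞) * ∑ _m ∈ Finset.range N, Cir * ENNReal.ofReal lam'⁻¹ :=
            mul_le_mul' le_rfl (Finset.sum_le_sum fun m hm ↦ hirb m (Finset.mem_range.1 hm) k hk s hs q)
        _ = _ := by rw [Finset.sum_const, Finset.card_range, nsmul_eq_mul]
    have hDq : ∀ q, sobolevEnergy k (rhoExpr P q (D s)) ≤ CDsup * XT * ((2⁻¹ : ℝ≥0∞) ^ N₀ * NΘT) := by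
      intro q
      refine (hsupD (Nat.succ_ne_zero N₀) k hkK s hs q).trans ?_
      rw [hNdef, Nat.add_sub_cancel]
      exact mul_le_mul' (mul_le_mul' le_rfl (hXle s hs)) (mul_le_mul' le_rfl (hNΘle k hkK s hs))
    have hsumq : ∀ q, sobolevEnergy k (rhoExpr P q fun x ↦ (∑ m ∈ Finset.range N, irf m s x) + D s x) ≤
        2 * ((N : ℝ≥0∞) * ((N : ℝ≥0∞) * (Cir * ENNReal.ofReal lam'⁻¹))) + 2 * (CDsup * XT * ((2⁻¹ : ℝ≥0∞) ^ N₀ * NΘT)) := by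
      intro q
      have heq : (rhoExpr P q fun x ↦ (∑ m ∈ Finset.range N, irf m s x) + D s x) = fun y ↦
          rhoExpr P q (fun x ↦ ∑ m ∈ Finset.range N, irf m s x) y + rhoExpr P q (D s) y := funext fun y ↦ rhoExpr_add q _ _ y
      rw [heq]
      refine (sobolevEnergy_add_le k ((contDiff_rhoExpr P q (hIRc q)).of_le (by exact_mod_cast le_top))
        ((contDiff_rhoExpr P q (hDc q)).of_le (by exact_mod_cast le_top))).trans ?_
      exact add_le_add (mul_le_mul' le_rfl (hIRq q)) (mul_le_mul' le_rfl (hDq q))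
    calc sobolevEnergy k (cutExpr P p fun x ↦ (∑ m ∈ Finset.range N, irf m s x) + D s x)
        ≤ Ccx p k * ∑ q, sobolevEnergy k (rhoExpr P q fun x ↦ (∑ m ∈ Finset.range N, irf m s x) + D s x) := hCcx p k hRc
      _ ≤ Ccxs * ∑ _q : ι, (2 * ((N : ℝ≥0∞) * ((N : ℝ≥0∞) * (Cir * ENNReal.ofReal lam'⁻¹))) +
            2 * (CDsup * XT * ((2⁻¹ : ℝ≥0∞) ^ N₀ * NΘT))) := mul_le_mul' (hCcxle p k hkK) (Finset.sum_le_sum fun q _ ↦ hsumq q)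
      _ = Hfin * ENNReal.ofReal lam'⁻¹ + (2⁻¹ : ℝ≥0∞) ^ N₀ * Gfin := by
          rw [Finset.sum_const, Finset.card_univ, nsmul_eq_mul, hHfin, hGfin]
          ring
      _ ≤ ENNReal.ofReal (ε / 2) + ENNReal.ofReal (ε / 2) := add_le_add hH hN₀
      _ = ENNReal.ofReal ε := by rw [← ENNReal.ofReal_add (by linarith) (by linarith), add_halves]

end Main

end PatchSystemLoc

end Literature.Analysis.PDE
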